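import Summits.MatrixMultiplication.MatrixMultiplication.Theses.SnSubsetDichotomy
import Summits.MatrixMultiplication.MatrixMultiplication.Theorems.SnSubsetDichotomyVershikKerovBound
import Summits.MatrixMultiplication.MatrixMultiplication.Theorems.SnSubsetDichotomyDichotomyInduction
import Summits.MatrixMultiplication.MatrixMultiplication.Theorems.SnSubsetDichotomyNoThresholdSubsetTripleStubTransfer
import Literature.Barriers.MatrixMultiplication.YoungSubgroupBarrierProofs
import Literature.Barriers.MatrixMultiplication.YoungSubgroupBarrierSTPP
import Literature.Barriers.MatrixMultiplication.NilpotentGroupBarrierSemisimple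
import Summits.MatrixMultiplication.MatrixMultiplication.Theses.SnThresholdCensus
import Summits.MatrixMultiplication.MatrixMultiplication.Theorems.SnSubsetDichotomyHyperoctahedralSubsetsPairwisePacking
import Summits.MatrixMultiplication.MatrixMultiplication.Theorems.SnSubsetDichotomyThresholdSubsetTriplesChainDefs
import Summits.MatrixMultiplication.MatrixMultiplication.Theorems.SnSubsetDichotomyThresholdSubsetTriplesStubChainProductCard
import Literature.Combinatorics.Enumerative.EntropyBregman

/-!
# Disproof of `ThresholdSubsetTriples` — findings (cdisprove, crux `stmt-MatrixMultiplication-10882`)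

The crux `X = SnSubsetDichotomy.ThresholdSubsetTriples` (rank 0, the route's TARGET and deciding side):
`∀ c > 0, ∀ n₀, ∃ n ≥ n₀, ∃ S T U ⊆ S_n` with the triple product property (TPP) and
`(n!)^{3/2}·e^{-c√n} < |S||T||U|` — TPP subset triples within `e^{-o(√n)}` of the packing bound.

VERDICT OF THIS FILE (gen 2 / v5, 2026-08-16; gen 1 = v1–v4): NO KILL.  A disproof of `X` is literally a
proof of the negative crux `NoThresholdSubsetTriple` (`stmt-MatrixMultiplication-8302`,
`not_thresholdSubsetTriples_iff`), the open "all triples of subsets of `S_n`" question of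
Blasiak–Church–Cohn–Grochow–Umans 2017 §4 with its own crux team; a proof of `X` is `ω(ℂ) = 2`
(`matrixMultiplication_of_thresholdSubsetTriples`).  Everything a cheap refuter can do is recorded below as
Lean theorems (all sorry-free).  v5 adds §6 (the `e^{O(√n)} ≪ √(n!)` bookkeeping and the void symmetric
ansatz `S = T`), §7 (picked line `interleaved-subsignature-ascent`: `LevelCondition` is the only load-bearing
conjunct of `stub_design`; the level rule `|E_i ∩ E_j| ≤ 1` formalised) and §8 (next line
`triality-uniquely-cubing-translate`: its design stub is `C⁺ = TrialityThreshold` in costume — the fibre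
bound is never used by the glue and the fibre-free stub is EQUIVALENT to `C⁺`; the twist `g = 1` is void;
fixed points of the twist are paid factorially, `|S|·|Fix g|! ≤ n!`, so a twist fixing `≥ 2n/3` points
carries no threshold set, `card_le_threshold_of_fixed_ge`).

LANDED in the tree (definition-free copies, namespace `…Theorems.ThresholdSubsetTriples.Negative`, importable
by ideators/planners/provers): `Theorems/ThresholdSubsetTriples/Negative/Packing.lean` (§0–§1, p83440),
`…/Negative/RootedStabilisers.lean` (§5 construction, p85180), `…/Negative/YoungAndSliceRank.lean`
(§2–§3, p85217), `…/Negative/NormalForms.lean` (§4–§4b, p85241), `…/Negative/RootedTripleNotTPP.lean` (§5,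
p88051); gen 2: `…/Negative/PairwiseVoid.lean` (§5b, never filed by gen 1; p117792),
`…/Negative/SymmetricAnsatz.lean` (§6, p117524), `…/Negative/ChainLevelRule.lean` (§7, p117534),
`…/Negative/TwistFixedPoints.lean` (§8b, p118069) — all ACCEPTED — and `…/Negative/TrialityStub.lean` (§8a,
p118433) — ACCEPTED as well.  The candidate proof of
`SnThresholdCensus.PairwiseTrivialAtThreshold` is attached to stmt-5541.

## Findings (section → declaration)

* §0 NORMAL FORMS — `thresholdSubsetTriples_iff_not_noThreshold`, `not_thresholdSubsetTriples_iff`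
  (`¬X ↔ NoThresholdSubsetTriple`: the disproof target IS crux 8302), `matrixMultiplication_of_…`
  (`X → MatrixMultiplication`, via the proved `closes` + `vershikKerovBound_proof`),
  `thresholdAt_anti` (the scale-`c` statement is monotone in `c`: refuting `X` = refuting ONE `c > 0`).
* §1 LOAD-BEARING PARTS OF `X` —
  `volume_sq_le_factorial_cube` / `volume_le_packing` (packing `|S||T||U| ≤ (n!)^{3/2}` for every TPP
  triple, all `n`); `thresholdSubsetTriples_false_without_pos` (drop `0 < c`: FALSE at `c = 0`, every `n`);
  `thresholdSubsetTriplesWithoutCofinal_holds` (drop `∀ n₀`: trivially TRUE at `n = 1` with `{1},{1},{1}`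
  — `1 > e^{-c}`; so only `n → ∞` carries content and small-`n` computation cannot refute);
  `thresholdSubsetTriplesWithoutTPP_holds` (drop the TPP: `S = T = U = S_n`); hence any refutation must use
  the TPP and must produce a saving `e^{-c√n}` for ONE fixed `c > 0` at ALL large `n`.
* §2 NATURAL STRENGTHENINGS REFUTED — `not_thresholdYoungTriples`: `X` restricted to triples of YOUNG
  SUBGROUPS is FALSE (tree theorem `BCCGU2017_thm42_holds`: pairwise-trivial Young triples have volume
  `≤ (n!)^{3/2} e^{-(3/2)(cn - d√n log n)}`; the TPP forces pairwise triviality,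
  `inf_eq_bot_of_tripleProductProperty`).  So a witness family for `X`, if any, is non-Young (the route's
  own constructive crux `HyperoctahedralThreshold` lives in `S_2 ≀ S_{n/2}`).  `not_beats_zero`: the
  `c = 0` strengthening (beat the packing bound) fails at every `n`.
* §3 WHAT WOULD KILL `X` (conditional disproofs, all sorry-free implications) —
  `not_thresholdSubsetTriples_of_noThreshold` (crux 8302), `…_of_branches` (`GlobalBranch ∧ JuntaBranch`,
  through the proved `dichotomyInduction_proof`), `…_of_sliceRankSaving F` (a slice-rank saving
  `SR_F(D_{S_n}) ≤ n!·e^{-K√n}` over ANY field, through the proved `stub_transfer`); and the no-go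
  `not_sliceRankSaving_of_charZero` / `sliceRank_perm_eq_factorial`: over a field in which `n! ≠ 0`
  (characteristic `0`, or `p > n`) the group tensor of `S_n` has FULL slice rank `n!` (tree theorem
  `BCCGU2017_corB7_holds`), so the slice-rank route to `¬X` is confined to modular characteristic `p ≤ n`
  — exactly where the negative crux team works (`𝔽̄₂`).
* §4 NORMAL FORMS OF A WITNESS — `thresholdSubsetTriples_iff_balanced`: `X ↔ ∀ c > 0`, for cofinally
  many `n`, `S_n` realizes `⟨N,N,N⟩` with `N > √(n!)·e^{-c√n}` (packing in three rotations + heredity;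
  constants `c ↦ c`, `c ↦ c/3`); `thresholdSubsetTriples_iff_nat` (scales `1/(k+1)` suffice);
  §4b `card_window_of_beats` (every set of a witness has size in `(√(n!)e^{-c√n}, √(n!)e^{c√n})` — hosts
  of order `≤ √(n!)e^{-c√n}` are excluded a priori) and `thresholdSubsetTriples_iff_rooted` (WLOG
  `1 ∈ S ∩ T ∩ U`, right-translation invariance).  A disproof may assume balanced, rooted witnesses.
* §5 PAIRWISE INFORMATION IS VOID — `thresholdSubsetTriplesPairwise_holds`: with the TPP weakened to its
  three two-set consequences (`PairwiseTPP`; implied by the TPP for non-empty sets,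
  `pairwiseTPP_of_tripleProductProperty`) the threshold statement is TRUE for every `c > 0`: the rooted
  stabilisers `K_a = C(μ_a) ∩ Stab(0)` of the matchings `{x, a-x}` of `ℤ/n`, `a = 1,3,5`, `n ≡ 2 mod 4`,
  are pairwise trivial (`rootedStab_inf_eq_bot`, fixed-point propagation `eq_one_of_commute_of_fix`) and
  satisfy `(n!)^{3/2} ≤ n³|K_1||K_3||K_5|` (`factorial_rpow_le_rootedTriple`: `|C(μ_a)| = 2^m m!`,
  orbit–stabiliser, `binom(2m,m) ≤ 4^m`).  By-product: a sorry-free proof of the sibling route's item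
  `SnThresholdCensus.PairwiseTrivialAtThreshold` (stmt-5541), `pairwiseTrivialAtThreshold_proof`.
  CONSEQUENCE: `¬X` needs the genuinely three-fold condition; packing / pairwise counting / host-size
  arguments stop at polynomial slack `n³`.  The configuration itself is not a witness for `X`:
  `rootedTriple_not_tpp` exhibits `σ₁σ₃σ₅ = 1`, `σ₁ ≠ 1`, `σ_a ∈ K_a`, uniformly in `n ≥ 6`.

* §6 BOOKKEEPING AND THE VOID SYMMETRIC ANSATZ — `exp_sqrt_le_sqrt_factorial` (`e^{c√n} ≤ √(n!)`
  eventually), `factorial_le_threshold` (`n! ≤ (n!)^{3/2}e^{-c√n}` eventually: a triple of volume `≤ n!`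
  is never a witness); `quot_eq_one_of_tpp` (`Q(S) ∩ Q(T) = {1}`, the pair rule T4), `card_le_one_of_tpp_self`
  (`TPP(S,S,U) ⇒ |S| ≤ 1`), `not_thresholdTwoEqualSets`: `X` restricted to `S = T` is FALSE — the `g = 1`
  case of every translate ansatz `T = gS`.
* §7 LINE `interleaved-subsignature-ascent` (lead c1-0; DEAD at `stub_design` = `X` on chain classes) —
  `stubDesignWithoutLevel_holds` (drop `LevelCondition`: the FULL systems `D k = {0..k}` pass at every
  scale, so `LevelCondition` and `0 < c` are the stub's only load-bearing conjuncts; `design_false_at_scale_zero`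
  is the skeleton's), `levelCondition_eq_of_mem_inter₁₂/₂₃/₁₃` + `levelCondition_card_add_card_add_card_le`
  (the level-local content of `LevelCondition`: pairwise intersections `≤ 1`, `|E₁|+|E₂|+|E₃| ≤ k + 4` at
  level `k` — capacity `((k+4)/3)³ ≫ (k+1)^{3/2}`, so levels are not the obstruction; the lead's slot-budget /
  owner-sibling analysis, census c3a–c3d, is what kills every known template, at `(n!)^{3/2}n^{-Θ(n)}`).
* §8 LINE `triality-uniquely-cubing-translate` (lead's next preference) — `stubWithoutFibres_iff_trialityThreshold`
  + `trialityThreshold_of_stub`: dropping the fibre bound `|lvl⁻¹ j| ≤ 3` from `stub_trialityChainDesign`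
  leaves EXACTLY `C⁺ = TrialityThreshold` (`X` on `ℤ/3`-translate triples, open), and the skeleton's glue
  discards that bound — the stub is `C⁺` restricted to a host family containing every subgroup design, so no
  cheap `stub_false` exists; `card_le_one_of_uniquelyCubing_one` (`g = 1` void, so `g³ = 1` ⇔ `orderOf g = 3`
  at threshold); `card_le_one_of_uniquelyCubing_of_conj_mem` (a `g`-conjugation-stable `S` is void: the
  design has no symmetry under its own twist); `uniquelyCubing_of_mul_subset` (hereditary twist conjugation:
  `r·B ⊆ S` ⇒ `Q(B)·gʳ` uniquely cubing for `gʳ = r⁻¹gr` — the tail of a chain product is a design for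
  every conjugate twist `gʳ`, `r ∈ R₀`); §8b `card_comm_mul_card_le` / `card_mul_factorial_fixed_le`: unique cubing packs
  `C(g) × S ↪ S_n`, hence `|S|·|Fix g|! ≤ |S|·|C(g)| ≤ n!` — fixed points of the twist cost factorially
  (`|Fix g| ≤ (1/2+o(1))n` at threshold from this count; the class count of the skeleton gives `1/4`);
  `card_le_threshold_of_fixed_ge`: REFUTED SUB-FAMILY — for every `c > 0` and all large `n`, a twist with
  `3·|Fix g| ≥ 2n` admits no uniquely-cubing `S` above `√(n!)e^{-c√n}` (`|S| ≤ n^{n-f} ≤ n^{n/3}`,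
  `log n! ≥ n log n − n` = tree `cast_mul_log_sub_le_log_factorial`).

## Why it resists (for the provers of either side)

* Upper bounds in print for a TPP triple in `S_n`: packing `(n!)^{3/2}` (all groups); BCGPU 2023 Thm 3.2
  `(n!)^{3/2}/√(n-1) + n!` (quasirandomness, `n(S_n) = n - 1`; tree fact `BCGPU2023_thm32_holds`, the value
  `n(S_n) = n-1` is NOT in the tree) — a saving `√n`, against the `e^{c√n}` needed.  Nothing better is
  published for general subsets (BCCGU 2017 §4–5 pose it as open); `PolynomialSlack` (saving `n^C ∀C`) is
  already an open crux of this route.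
* Lower bounds (constructions): Young "triangle/hexagon" triples reach `(n!)^{3/2} e^{-O(n)}` (Cohn–Umans
  2003 §7 / BCCGU 2017 Thm 4.1; not formalised here), and no family within `e^{-o(n)}` — let alone
  `e^{-o(√n)}` — of the packing bound is known in ANY group.  The gap any proof or disproof must close is
  `e^{-O(n)} … e^{-o(√n)}`.
* Barrier reductions tried: YoungSubgroupBarrier — bites only on Young triples (§2); QuasirandomBarrier —
  saving `√(n-1)` only; slice rank — void in good characteristic (§3), open in characteristic `2`
  (= line `two-modular-loewy-slice-rank` of crux 8302); NormalizerBarrier — subgroup hosts only;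
  spectral/support functionals of `⟨a,b,c⟩ ≤ ℂ[S_n]` give `(abc)^{1/3} ≤ Σ_λ f^λ ≈ √(n!)e^{+√n}`, WEAKER
  than packing.  Finite computation is void (§1: `∃ n ≥ n₀`).
* Pairwise information is void (§5, proved): three pairwise-trivially-intersecting subgroups of `S_n`
  reach the threshold up to `n³`, so `¬X` needs the genuinely three-fold condition at density
  `(n!)^{-1/2} e^{±c√n}` — where the only engines in print (Keevash–Lifshitz hypercontractivity,
  `log(1/μ) ≲ n`) are void (route § Numbers O1/O2).
* Lines (gen 2): all three registered lines (`SketchIdeator2` / `triality-uniquely-cubing-translate` /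
  `interleaved-subsignature-ascent`) reduce to ONE open design stub each, and each such stub is `X` (or its
  symmetric form `C⁺`) restricted to a host family that contains all subgroup resp. all Young designs
  (§7–§8; siege notes `stubBlockedHosts_iff_trialityThreshold`); refuting any of them is a case of BCCGU 2017
  §4's open question, not a small-model computation (§1: finite `n` is void).  The data side (lead censuses
  c1–c3d) shows level efficiencies FALLING along every tower; the theory side has no inequality bounding
  chain-class or triality designs below `(n!)^{3/2}e^{-c√n}`.  Literature sweep 2026-08-16 (gen 2):
  search-degraded (local index reset, OpenAlex/S2 HTTP 429); zbMATH 2023+ "triple product property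
  symmetric group": nothing relevant; galaxy pdf: Sawin arXiv:1702.00905 (matchings in G^n, not S_n),
  BCGPU ITCS 2025 (infinite groups) — no new bound for subsets of `S_n`.
* What a KILL would look like (recorded for the next seat): either (i) the modular slice-rank saving
  `SliceRankSaving 𝔽̄₂` (line `two-modular-loewy-slice-rank`, stub `stub_radicalWindow`: radical layers
  of `𝔽̄₂S_n` concentrated in a depth window `[b, 2b]` up to `n!e^{-K√n}`), fed into
  `not_thresholdSubsetTriples_of_sliceRankSaving`; or (ii) `GlobalBranch ∧ JuntaBranch` fed into
  `not_thresholdSubsetTriples_of_branches`; or (iii) a direct three-fold counting argument on balanced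
  rooted witnesses (§4, §4b) that survives §5's pairwise-trivial configuration.
-/

noncomputable section

set_option linter.dupNamespace false

open scoped BigOperators Pointwise

namespace Summit.MatrixMultiplication.MatrixMultiplication.Cruxes.ThresholdSubsetTriples.Disproof

open Summit.MatrixMultiplication.MatrixMultiplication.Theses.SnSubsetDichotomy
open Summit.MatrixMultiplication.MatrixMultiplication.Theorems
open Literature.Combinatorics.Additive
open Literature.Computability.AlgebraicComplexity
open Literature.Barriers.MatrixMultiplication
open Summit.MatrixMultiplication.MatrixMultiplication.Theorems.HyperoctahedralSubsets.PairwisePacking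
open Summit.MatrixMultiplication.MatrixMultiplication.Theorems.ThresholdSubsetTriples

/-! ## §0 Normal forms and resistance -/

/-- The volume condition of the crux at scale `c`: `(n!)^{3/2}·e^{-c√n} < |S||T||U|`. -/
def Beats (c : ℝ) (n : ℕ) (S T U : Finset (Equiv.Perm (Fin n))) : Prop :=
  (n.factorial : ℝ) ^ ((3 : ℝ) / 2) * Real.exp (-(c * Real.sqrt (n : ℝ))) <
    ((S.card * T.card * U.card : ℕ) : ℝ)

/-- The crux at one fixed scale `c`: threshold TPP triples exist for cofinally many `n`. -/
def ThresholdAt (c : ℝ) : Prop :=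
  ∀ n₀ : ℕ, ∃ n ≥ n₀, ∃ S T U : Finset (Equiv.Perm (Fin n)),
    TripleProductProperty S T U ∧ Beats c n S T U

/-- `X` is literally `∀ c > 0, ThresholdAt c`. -/
theorem thresholdSubsetTriples_iff_forall_thresholdAt :
    ThresholdSubsetTriples ↔ ∀ c : ℝ, 0 < c → ThresholdAt c :=
  Iff.rfl

/-- `Beats` is monotone in the scale: a larger `c` is a weaker demand. -/
theorem Beats.mono {c c' : ℝ} (hcc : c ≤ c') {n : ℕ} {S T U : Finset (Equiv.Perm (Fin n))}
    (h : Beats c n S T U) : Beats c' n S T U := by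
  unfold Beats at h ⊢
  refine lt_of_le_of_lt ?_ h
  have hs : 0 ≤ Real.sqrt (n : ℝ) := Real.sqrt_nonneg _
  gcongr

/-- `ThresholdAt` is monotone in `c`; hence `¬X ↔ ∃ c > 0, ¬ThresholdAt c`, and refuting `X` means
refuting ONE positive scale (then all smaller ones fail too). -/
theorem thresholdAt_anti {c c' : ℝ} (hcc : c ≤ c') (h : ThresholdAt c) : ThresholdAt c' := by
  intro n₀
  obtain ⟨n, hn, S, T, U, hT, hB⟩ := h n₀
  exact ⟨n, hn, S, T, U, hT, hB.mono hcc⟩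

/-- `X → ¬ NoThresholdSubsetTriple`. -/
theorem not_noThreshold_of_threshold (h : ThresholdSubsetTriples) : ¬ NoThresholdSubsetTriple := by
  rintro ⟨c, hc, n₀, hN⟩
  obtain ⟨n, hn, S, T, U, hTPP, hlt⟩ := h c hc n₀
  exact absurd (hN n hn S T U hTPP) (not_le.2 hlt)

/-- `¬ NoThresholdSubsetTriple → X`. -/
theorem threshold_of_not_noThreshold (h : ¬ NoThresholdSubsetTriple) : ThresholdSubsetTriples := by
  intro c hc n₀
  by_contra hcon
  refine h ⟨c, hc, n₀, fun n hn S T U hTPP => ?_⟩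
  by_contra hle
  exact hcon ⟨n, hn, S, T, U, hTPP, not_le.1 hle⟩

/-- The target and the negative crux are each other's negation (support item
`NoThresholdIffNotThreshold`, here re-proved for self-containedness). -/
theorem thresholdSubsetTriples_iff_not_noThreshold :
    ThresholdSubsetTriples ↔ ¬ NoThresholdSubsetTriple :=
  ⟨not_noThreshold_of_threshold, threshold_of_not_noThreshold⟩

/-- **The disproof target.** `¬X` is EXACTLY crux `stmt-MatrixMultiplication-8302`. -/
theorem not_thresholdSubsetTriples_iff : ¬ ThresholdSubsetTriples ↔ NoThresholdSubsetTriple := by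
  rw [thresholdSubsetTriples_iff_not_noThreshold, not_not]

/-- **Resistance on the positive side.** `X` proves the summit `ω(ℂ) = 2` outright (the route's proved
deciding theorem `closes` and the proved Vershik–Kerov bound). -/
theorem matrixMultiplication_of_thresholdSubsetTriples (h : ThresholdSubsetTriples) :
    _root_.MatrixMultiplication :=
  closes h vershikKerovBound_proof

/-! ## §1 Load-bearing parts of the statement -/

/-- **Packing, squared integer form**: `(|S||T||U|)² ≤ (n!)³` for every TPP triple in `S_n`
(the three rotations `|S||T|, |T||U|, |U||S| ≤ n!` of Cohn–Umans' injectivity of `(s,t) ↦ s⁻¹t`;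
empty sets give `0`). -/
theorem volume_sq_le_factorial_cube {n : ℕ} {S T U : Finset (Equiv.Perm (Fin n))}
    (h : TripleProductProperty S T U) :
    (S.card * T.card * U.card) ^ 2 ≤ n.factorial ^ 3 := by
  by_cases hS : S.card = 0
  · simp [hS]
  by_cases hT : T.card = 0
  · simp [hT]
  by_cases hU : U.card = 0
  · simp [hU]
  obtain ⟨h1, h2, h3⟩ := tpp_perm_card_mul_card_le_factorial h hS hT hU
  calc (S.card * T.card * U.card) ^ 2
      = (S.card * T.card) * (T.card * U.card) * (U.card * S.card) := by ring
    _ ≤ n.factorial * n.factorial * n.factorial :=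
        Nat.mul_le_mul (Nat.mul_le_mul h1 h2) h3
    _ = n.factorial ^ 3 := by ring

/-- **Packing, real form**: `|S||T||U| ≤ (n!)^{3/2}` for every TPP triple in `S_n` and every `n`. -/
theorem volume_le_packing {n : ℕ} {S T U : Finset (Equiv.Perm (Fin n))}
    (h : TripleProductProperty S T U) :
    ((S.card * T.card * U.card : ℕ) : ℝ) ≤ (n.factorial : ℝ) ^ ((3 : ℝ) / 2) := by
  have hsq : (((S.card * T.card * U.card : ℕ) : ℝ)) ^ 2 ≤ ((n.factorial : ℝ)) ^ 3 := by
    exact_mod_cast volume_sq_le_factorial_cube h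
  have hF : (0 : ℝ) ≤ (n.factorial : ℝ) := Nat.cast_nonneg _
  have hV : (0 : ℝ) ≤ ((S.card * T.card * U.card : ℕ) : ℝ) := Nat.cast_nonneg _
  calc ((S.card * T.card * U.card : ℕ) : ℝ)
      = Real.sqrt ((((S.card * T.card * U.card : ℕ) : ℝ)) ^ 2) := by rw [Real.sqrt_sq hV]
    _ ≤ Real.sqrt (((n.factorial : ℝ)) ^ 3) := Real.sqrt_le_sqrt hsq
    _ = (n.factorial : ℝ) ^ ((3 : ℝ) / 2) := by
        rw [Real.sqrt_eq_rpow, ← Real.rpow_natCast, ← Real.rpow_mul hF]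
        norm_num

/-- The `c = 0` instance of the volume condition fails for EVERY TPP triple at EVERY `n`
(it asks to beat the packing bound). -/
theorem not_beats_zero {n : ℕ} {S T U : Finset (Equiv.Perm (Fin n))}
    (h : TripleProductProperty S T U) : ¬ Beats 0 n S T U := by
  unfold Beats
  rw [zero_mul, neg_zero, Real.exp_zero, mul_one, not_lt]
  exact volume_le_packing h

/-- `X` with the positivity hypothesis `0 < c` dropped. -/
def ThresholdSubsetTriplesWithoutPos : Prop :=
  ∀ c : ℝ, ∀ n₀ : ℕ, ∃ n ≥ n₀, ∃ S T U : Finset (Equiv.Perm (Fin n)),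
    TripleProductProperty S T U ∧ Beats c n S T U

/-- **`0 < c` is load-bearing**: without it the statement is false (witness `c = 0`, packing). -/
theorem thresholdSubsetTriples_false_without_pos : ¬ ThresholdSubsetTriplesWithoutPos := by
  intro h
  obtain ⟨n, -, S, T, U, hTPP, hlt⟩ := h 0 0
  exact not_beats_zero hTPP hlt

/-- `X` with the cofinality `∀ n₀, ∃ n ≥ n₀` weakened to `∃ n`. -/
def ThresholdSubsetTriplesWithoutCofinal : Prop :=
  ∀ c : ℝ, 0 < c → ∃ n : ℕ, ∃ S T U : Finset (Equiv.Perm (Fin n)),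
    TripleProductProperty S T U ∧ Beats c n S T U

/-- The one-element triple `{1}, {1}, {1}` has the TPP in every group. -/
theorem tpp_singleton_one {G : Type*} [Group G] [DecidableEq G] :
    TripleProductProperty ({1} : Finset G) {1} {1} := by
  intro s hs s' hs' t ht t' ht' u hu u' hu' _
  simp only [Finset.mem_singleton] at hs hs' ht ht' hu hu'
  exact ⟨hs.trans hs'.symm, ht.trans ht'.symm, hu.trans hu'.symm⟩

/-- At `n = 1` the trivial triple beats every positive scale: `1 > 1^{3/2}·e^{-c}`. -/
theorem beats_one_singleton {c : ℝ} (hc : 0 < c) :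
    Beats c 1 ({1} : Finset (Equiv.Perm (Fin 1))) {1} {1} := by
  have h : Real.exp (-c) < 1 := Real.exp_lt_one_iff.2 (neg_lt_zero.2 hc)
  simpa [Beats] using h

/-- **Cofinality is what makes `X` non-trivial**: without `∀ n₀` it holds at `n = 1` for every `c > 0`
(so no bounded search in small `S_n` bears on `X`; at `n = 0` the bound is `1 < 1`, false). -/
theorem thresholdSubsetTriplesWithoutCofinal_holds : ThresholdSubsetTriplesWithoutCofinal :=
  fun _ hc => ⟨1, {1}, {1}, {1}, tpp_singleton_one, beats_one_singleton hc⟩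

/-- `X` with the triple product property dropped. -/
def ThresholdSubsetTriplesWithoutTPP : Prop :=
  ∀ c : ℝ, 0 < c → ∀ n₀ : ℕ, ∃ n ≥ n₀, ∃ S T U : Finset (Equiv.Perm (Fin n)), Beats c n S T U

/-- `S_n, S_n, S_n` beats every positive scale as soon as `n ≥ 1` (volume `(n!)³`). -/
theorem beats_univ {c : ℝ} (hc : 0 < c) {n : ℕ} (hn : 1 ≤ n) :
    Beats c n Finset.univ Finset.univ Finset.univ := by
  unfold Beats
  have hF1 : (1 : ℝ) ≤ (n.factorial : ℝ) := by
    exact_mod_cast Nat.succ_le_of_lt (Nat.factorial_pos n)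
  have hcard : (Finset.univ : Finset (Equiv.Perm (Fin n))).card = n.factorial := by
    rw [Finset.card_univ, Fintype.card_perm, Fintype.card_fin]
  rw [hcard]
  have hexp : Real.exp (-(c * Real.sqrt (n : ℝ))) < 1 := by
    rw [Real.exp_lt_one_iff, neg_lt_zero]
    exact mul_pos hc (Real.sqrt_pos.2 (by exact_mod_cast hn))
  have hpow : (n.factorial : ℝ) ^ ((3 : ℝ) / 2) ≤ (n.factorial : ℝ) ^ ((3 : ℝ)) :=
    Real.rpow_le_rpow_of_exponent_le hF1 (by norm_num)
  calc (n.factorial : ℝ) ^ ((3 : ℝ) / 2) * Real.exp (-(c * Real.sqrt (n : ℝ)))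
      < (n.factorial : ℝ) ^ ((3 : ℝ) / 2) * 1 := mul_lt_mul_of_pos_left hexp (by positivity)
    _ ≤ (n.factorial : ℝ) ^ ((3 : ℝ)) := by rw [mul_one]; exact hpow
    _ = ((n.factorial * n.factorial * n.factorial : ℕ) : ℝ) := by
        rw [show (3 : ℝ) = ((3 : ℕ) : ℝ) by norm_num, Real.rpow_natCast]
        push_cast
        ring

/-- **The TPP is load-bearing** (trivially): without it the volume condition is met by `S_n` itself. -/
theorem thresholdSubsetTriplesWithoutTPP_holds : ThresholdSubsetTriplesWithoutTPP :=
  fun _ hc n₀ => ⟨max n₀ 1, le_max_left _ _, Finset.univ, Finset.univ, Finset.univ,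
    beats_univ hc (le_max_right _ _)⟩

/-! ## §2 Natural strengthenings refuted -/

/-- A Young subgroup of `S_n` as a `Finset` (labelling `f`; the tree's `youngSubgroup`). -/
abbrev youngSet {n : ℕ} (f : Fin n → ℕ) : Finset (Equiv.Perm (Fin n)) :=
  Finset.univ.filter (· ∈ youngSubgroup f)

/-- A subgroup, filtered out of `univ`, has `Nat.card` many elements. -/
theorem card_filter_mem_subgroup {G : Type*} [Group G] [Fintype G] (H : Subgroup G)
    [DecidablePred (· ∈ H)] : (Finset.univ.filter (· ∈ H)).card = Nat.card H := by
  rw [Nat.card_eq_fintype_card,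
    Fintype.card_of_subtype (Finset.univ.filter (· ∈ H)) (fun x => by simp)]

/-- Cardinality of a Young subgroup as a `Finset`. -/
theorem card_youngSet {n : ℕ} (f : Fin n → ℕ) :
    (youngSet f).card = Nat.card (youngSubgroup f) :=
  card_filter_mem_subgroup _

/-- `X` restricted to triples of YOUNG SUBGROUPS (the Cohn–Umans 2003 "triangle" host class). -/
def ThresholdYoungTriples : Prop :=
  ∀ c : ℝ, 0 < c → ∀ n₀ : ℕ, ∃ n ≥ n₀, ∃ f₁ f₂ f₃ : Fin n → ℕ,
    TripleProductProperty (youngSet f₁) (youngSet f₂) (youngSet f₃) ∧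
      Beats c n (youngSet f₁) (youngSet f₂) (youngSet f₃)

/-- The Young-restricted statement is a strengthening of `X`. -/
theorem thresholdSubsetTriples_of_young (h : ThresholdYoungTriples) : ThresholdSubsetTriples := by
  intro c hc n₀
  obtain ⟨n, hn, f₁, f₂, f₃, hT, hB⟩ := h c hc n₀
  exact ⟨n, hn, _, _, _, hT, hB⟩

/-- Real bookkeeping: `d·log n + 2c/3 ≤ c·√n` for all large `n` (`log = o(√·)`). -/
theorem eventually_dlog_le_sqrt (c d : ℝ) (hc : 0 < c) :
    ∃ n₀ : ℕ, 2 ≤ n₀ ∧ ∀ n : ℕ, n₀ ≤ n → d * Real.log n + 2 * c / 3 ≤ c * Real.sqrt n := by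
  have hε : 0 < c / (2 * (|d| + 1)) := by positivity
  have hlo := (isLittleO_log_rpow_atTop (show (0 : ℝ) < 1 / 2 by norm_num)).bound hε
  obtain ⟨a, ha⟩ := Filter.eventually_atTop.1 hlo
  refine ⟨max 2 ⌈a⌉₊, le_max_left _ _, fun n hn => ?_⟩
  have hn2 : (2 : ℝ) ≤ n := by exact_mod_cast (le_max_left _ _).trans hn
  have hna : a ≤ n := (Nat.le_ceil a).trans (by exact_mod_cast (le_max_right _ _).trans hn)
  have hb := ha n hna
  rw [Real.norm_eq_abs, Real.norm_eq_abs, abs_of_nonneg (Real.rpow_nonneg (by positivity) _),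
    ← Real.sqrt_eq_rpow] at hb
  -- `hb : |log n| ≤ c/(2(|d|+1)) · √n`
  have hsqrt : (4 : ℝ) / 3 ≤ Real.sqrt n := by
    have h2 : Real.sqrt 2 ≤ Real.sqrt n := Real.sqrt_le_sqrt hn2
    have h43 : (4 : ℝ) / 3 ≤ Real.sqrt 2 := by
      rw [Real.le_sqrt (by norm_num) (by norm_num)]
      norm_num
    linarith
  have h1 : d * Real.log n ≤ |d| * |Real.log n| :=
    calc d * Real.log n ≤ |d * Real.log n| := le_abs_self _
      _ = |d| * |Real.log n| := abs_mul _ _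
  have h2 : |d| * |Real.log n| ≤ |d| * (c / (2 * (|d| + 1)) * Real.sqrt n) :=
    mul_le_mul_of_nonneg_left hb (abs_nonneg d)
  have hfrac : |d| * (c / (2 * (|d| + 1))) ≤ c / 2 := by
    have hq : |d| / (|d| + 1) ≤ 1 := div_le_one_of_le₀ (by linarith) (by positivity)
    have hd1 : (|d| + 1) ≠ 0 := by positivity
    calc |d| * (c / (2 * (|d| + 1))) = c / 2 * (|d| / (|d| + 1)) := by
          field_simp
      _ ≤ c / 2 := mul_le_of_le_one_right (by positivity) hq
  have h3 : |d| * (c / (2 * (|d| + 1)) * Real.sqrt n) ≤ c / 2 * Real.sqrt n := by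
    rw [← mul_assoc]
    exact mul_le_mul_of_nonneg_right hfrac (Real.sqrt_nonneg _)
  have h4 : c * (4 / 3) ≤ c * Real.sqrt n := mul_le_mul_of_nonneg_left hsqrt hc.le
  linarith

/-- **`X` for Young triples is FALSE** (Blasiak–Church–Cohn–Grochow–Umans 2017, Thm. 4.2, tree theorem
`BCCGU2017_thm42_holds`): with the theorem's constants `c, d`, a Young TPP triple has pairwise trivial
intersections (`inf_eq_bot_of_tripleProductProperty`), hence `e^{cn-d√n log n} ≤ n!/V^{2/3}`, i.e.
`log V ≤ (3/2)(log n! - cn + d√n log n)`, while the threshold at scale `c` says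
`log V > (3/2) log n! - c√n`; for `n` with `d log n + 2c/3 ≤ c√n` these are incompatible.  So the
counterexample family `X` asks for is NOT made of Young subgroups. -/
theorem not_thresholdYoungTriples : ¬ ThresholdYoungTriples := by
  intro h
  obtain ⟨c, d, hc, _, H⟩ := BCCGU2017_thm42_holds
  obtain ⟨n₀, hn₀2, hev⟩ := eventually_dlog_le_sqrt c d hc
  obtain ⟨n, hn, f₁, f₂, f₃, hTPP, hlt⟩ := h c hc n₀
  have hn2 : 2 ≤ n := hn₀2.trans hn
  obtain ⟨h12, h23, h13⟩ :=
    inf_eq_bot_of_tripleProductProperty (youngSubgroup f₁) (youngSubgroup f₂) (youngSubgroup f₃) hTPP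
  have h42 := H n hn2 f₁ f₂ f₃ h12 h23 h13
  unfold Beats at hlt
  rw [card_youngSet, card_youngSet, card_youngSet] at hlt
  set V : ℝ := ((Nat.card (youngSubgroup f₁) * Nat.card (youngSubgroup f₂) *
    Nat.card (youngSubgroup f₃) : ℕ) : ℝ) with hV
  set F : ℝ := (n.factorial : ℝ) with hF
  set s : ℝ := Real.sqrt n with hs
  have hF0 : 0 < F := by rw [hF]; exact_mod_cast n.factorial_pos
  have hM0 : 0 < F ^ ((3 : ℝ) / 2) * Real.exp (-(c * s)) := by positivity
  have hV0 : 0 < V := hM0.trans hlt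
  -- Thm 4.2 in logarithms: `c n - d s log n ≤ log F - (2/3) log V`
  have hlog42 : c * n - d * s * Real.log n ≤ Real.log F - 2 / 3 * Real.log V := by
    have h1 : Real.log (Real.exp (c * n - d * s * Real.log n)) ≤ Real.log (F / V ^ (2 / 3 : ℝ)) :=
      Real.log_le_log (Real.exp_pos _) h42
    rw [Real.log_exp, Real.log_div hF0.ne' (Real.rpow_pos_of_pos hV0 _).ne', Real.log_rpow hV0] at h1
    linarith
  -- the threshold in logarithms: `(3/2) log F - c s < log V`
  have hlogV : 3 / 2 * Real.log F + -(c * s) < Real.log V := by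
    have h1 : Real.log (F ^ ((3 : ℝ) / 2) * Real.exp (-(c * s))) < Real.log V := Real.log_lt_log hM0 hlt
    rw [Real.log_mul (Real.rpow_pos_of_pos hF0 _).ne' (Real.exp_pos _).ne', Real.log_rpow hF0,
      Real.log_exp] at h1
    linarith
  have hkey : c * n - d * s * Real.log n < 2 * c / 3 * s := by linarith
  -- the eventual inequality, multiplied by `s = √n`
  have hss : s * s = n := by rw [hs]; exact Real.mul_self_sqrt (Nat.cast_nonneg n)
  have hs0 : 0 ≤ s := Real.sqrt_nonneg _
  have hev' : (d * Real.log n + 2 * c / 3) * s ≤ c * n := by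
    calc (d * Real.log n + 2 * c / 3) * s ≤ (c * Real.sqrt n) * s :=
          mul_le_mul_of_nonneg_right (hev n hn) hs0
      _ = c * (s * s) := by rw [hs]; ring
      _ = c * n := by rw [hss]
  nlinarith [hev', hkey]

/-! ## §3 What would kill `X`: conditional disproofs, and where they cannot come from -/

/-- A proof of the negative crux (stmt-8302) refutes `X`. -/
theorem not_thresholdSubsetTriples_of_noThreshold (h : NoThresholdSubsetTriple) :
    ¬ ThresholdSubsetTriples :=
  fun hX => not_noThreshold_of_threshold hX h

/-- The route's global/junta dichotomy refutes `X` (through the PROVED glue `dichotomyInduction_proof`);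
both branches are open cruxes (8303, 8304). -/
theorem not_thresholdSubsetTriples_of_branches (hG : GlobalBranch) (hJ : JuntaBranch) :
    ¬ ThresholdSubsetTriples :=
  not_thresholdSubsetTriples_of_noThreshold (dichotomyInduction_proof hG hJ)

/-- The slice-rank saving `C⁺` for the group tensor `D_{S_n}(x,y,z) = [xyz = 1]` over a field `F`:
`slice-rank ≤ n!·e^{-K√n}` eventually, for some `K > 0` (BCCGU 2017 §6 conjecture, weak form). -/
def SliceRankSaving (F : Type) [Field F] : Prop :=
  ∃ K : ℝ, 0 < K ∧ ∃ n₀ : ℕ, ∀ n ≥ n₀,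
    (sliceRank (mulGroupTensor F (Equiv.Perm (Fin n))) : ℝ) ≤
      (n.factorial : ℝ) * Real.exp (-(K * Real.sqrt (n : ℝ)))

/-- A slice-rank saving over ANY field refutes `X` (the PROVED transfer `stub_transfer` of line
`two-modular-loewy-slice-rank`: packing + heredity + `N² ≤ slice-rank`, BCCGU 2017 Prop. B.6). -/
theorem not_thresholdSubsetTriples_of_sliceRankSaving (F : Type) [Field F] (h : SliceRankSaving F) :
    ¬ ThresholdSubsetTriples :=
  not_thresholdSubsetTriples_of_noThreshold (stub_transfer F h)

/-- In a field in which `n! ≠ 0` the group tensor of `S_n` has FULL slice rank `n!`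
(BCCGU 2017 Cor. B.7, tree theorem `BCCGU2017_corB7_holds`, all-fields form). -/
theorem sliceRank_perm_eq_factorial (F : Type) [Field F] {n : ℕ} (hchar : (n.factorial : F) ≠ 0) :
    sliceRank (mulGroupTensor F (Equiv.Perm (Fin n))) = n.factorial := by
  have hcard : Fintype.card (Equiv.Perm (Fin n)) = n.factorial := by
    rw [Fintype.card_perm, Fintype.card_fin]
  have h := BCCGU2017_corB7_holds.of_field F (Equiv.Perm (Fin n)) (by rwa [hcard])
  rwa [hcard] at h

/-- **No-go: the slice-rank route is modular.**  Over a field of characteristic `0` there is no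
slice-rank saving at all (full slice rank `n!` at every `n ≥ 1`), so `not_thresholdSubsetTriples_of_
sliceRankSaving` can only ever be fed in characteristic `p ≤ n` (for fixed `p > 0` and `n < p` the slice
rank is again full, `sliceRank_perm_eq_factorial`). -/
theorem not_sliceRankSaving_of_charZero (F : Type) [Field F] [CharZero F] : ¬ SliceRankSaving F := by
  rintro ⟨K, hK, n₀, h⟩
  set m : ℕ := max n₀ 1 with hm
  have hn := h m (le_max_left _ _)
  rw [sliceRank_perm_eq_factorial F (by exact_mod_cast (Nat.factorial_pos m).ne')] at hn
  have hF : (0 : ℝ) < (m.factorial : ℝ) := by exact_mod_cast Nat.factorial_pos m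
  have hm1 : (0 : ℝ) < (m : ℝ) := by exact_mod_cast (le_max_right n₀ 1 : 1 ≤ m)
  have hexp : Real.exp (-(K * Real.sqrt (m : ℝ))) < 1 := by
    rw [Real.exp_lt_one_iff, neg_lt_zero]
    exact mul_pos hK (Real.sqrt_pos.2 hm1)
  have hlt : (m.factorial : ℝ) * Real.exp (-(K * Real.sqrt (m : ℝ))) < m.factorial :=
    calc (m.factorial : ℝ) * Real.exp (-(K * Real.sqrt (m : ℝ))) < (m.factorial : ℝ) * 1 :=
          mul_lt_mul_of_pos_left hexp hF
      _ = m.factorial := mul_one _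
  linarith

/-! ## §4 Balanced normal form -/

/-- `X` in balanced form: `S_n` realizes `⟨N,N,N⟩` with `N > √(n!)·e^{-c√n}`, cofinally in `n`, for
every `c > 0`. -/
def ThresholdBalanced : Prop :=
  ∀ c : ℝ, 0 < c → ∀ n₀ : ℕ, ∃ n ≥ n₀, ∃ N : ℕ,
    RealizesTPP (Equiv.Perm (Fin n)) N N N ∧
      Real.sqrt (n.factorial : ℝ) * Real.exp (-(c * Real.sqrt (n : ℝ))) < N

/-- `X → balanced X` (same scale `c`): a threshold triple is non-empty, packing in three rotations gives
`|S||T||U| ≤ N·n!` for `N = min(|S|,|T|,|U|)`, so `N > √(n!)e^{-c√n}`, and heredity shrinks the triple to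
three `N`-sets (`tpp_perm_card_mul_le_min_mul_factorial`, `tpp_perm_realizesTPP_of_le`). -/
theorem thresholdBalanced_of_thresholdSubsetTriples (h : ThresholdSubsetTriples) :
    ThresholdBalanced := by
  intro c hc n₀
  obtain ⟨n, hn, S, T, U, hTPP, hlt⟩ := h c hc n₀
  have hprod : 0 < S.card * T.card * U.card := by
    have h0 : (0 : ℝ) < ((S.card * T.card * U.card : ℕ) : ℝ) := lt_of_le_of_lt (by positivity) hlt
    exact_mod_cast h0
  have hS0 : S.card ≠ 0 := fun h0 => by simp [h0] at hprod
  have hT0 : T.card ≠ 0 := fun h0 => by simp [h0] at hprod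
  have hU0 : U.card ≠ 0 := fun h0 => by simp [h0] at hprod
  have hNprod := tpp_perm_card_mul_le_min_mul_factorial hTPP hS0 hT0 hU0
  have hNS : min S.card (min T.card U.card) ≤ S.card := min_le_left _ _
  have hNT : min S.card (min T.card U.card) ≤ T.card := (min_le_right _ _).trans (min_le_left _ _)
  have hNU : min S.card (min T.card U.card) ≤ U.card :=
    (min_le_right _ _).trans (min_le_right _ _)
  generalize min S.card (min T.card U.card) = N at hNprod hNS hNT hNU
  refine ⟨n, hn, N, tpp_perm_realizesTPP_of_le hTPP hNS hNT hNU, ?_⟩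
  have hF : (0 : ℝ) < (n.factorial : ℝ) := by exact_mod_cast Nat.factorial_pos n
  set F : ℝ := (n.factorial : ℝ) with hFdef
  set e : ℝ := Real.exp (-(c * Real.sqrt (n : ℝ))) with hedef
  have hrpow : F ^ ((3 : ℝ) / 2) = F * Real.sqrt F := by
    rw [Real.rpow_div_two_eq_sqrt _ hF.le, Real.rpow_ofNat, pow_succ, Real.sq_sqrt hF.le]
  have h1 : F * (Real.sqrt F * e) < F * N :=
    calc F * (Real.sqrt F * e) = F ^ ((3 : ℝ) / 2) * e := by rw [hrpow, mul_assoc]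
      _ < ((S.card * T.card * U.card : ℕ) : ℝ) := hlt
      _ ≤ (N : ℝ) * F := by rw [hFdef]; exact_mod_cast hNprod
      _ = F * N := mul_comm _ _
  exact lt_of_mul_lt_mul_left h1 hF.le

/-- `balanced X → X` (scale `c/3 ↦ c`): `N³ > (√(n!)e^{-(c/3)√n})³ = (n!)^{3/2}e^{-c√n}`. -/
theorem thresholdSubsetTriples_of_thresholdBalanced (h : ThresholdBalanced) :
    ThresholdSubsetTriples := by
  intro c hc n₀
  obtain ⟨n, hn, N, ⟨S, T, U, hS, hT, hU, hTPP⟩, hlt⟩ := h (c / 3) (by positivity) n₀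
  refine ⟨n, hn, S, T, U, hTPP, ?_⟩
  have hF : (0 : ℝ) < (n.factorial : ℝ) := by exact_mod_cast Nat.factorial_pos n
  set F : ℝ := (n.factorial : ℝ) with hFdef
  have h0 : 0 ≤ Real.sqrt F * Real.exp (-(c / 3 * Real.sqrt (n : ℝ))) := by positivity
  have hcube : (Real.sqrt F * Real.exp (-(c / 3 * Real.sqrt (n : ℝ)))) ^ 3 < (N : ℝ) ^ 3 :=
    pow_lt_pow_left₀ hlt h0 three_ne_zero
  have h3 : ((3 : ℕ) : ℝ) * -(c / 3 * Real.sqrt (n : ℝ)) = -(c * Real.sqrt (n : ℝ)) := by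
    push_cast
    ring
  have hlhs : (Real.sqrt F * Real.exp (-(c / 3 * Real.sqrt (n : ℝ)))) ^ 3 =
      F ^ ((3 : ℝ) / 2) * Real.exp (-(c * Real.sqrt (n : ℝ))) := by
    rw [mul_pow, Real.rpow_div_two_eq_sqrt _ hF.le, Real.rpow_ofNat, ← Real.exp_nat_mul, h3]
  have hrhs : ((N : ℝ)) ^ 3 = ((S.card * T.card * U.card : ℕ) : ℝ) := by
    rw [hS, hT, hU]
    push_cast
    ring
  show F ^ ((3 : ℝ) / 2) * Real.exp (-(c * Real.sqrt (n : ℝ))) < ((S.card * T.card * U.card : ℕ) : ℝ)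
  rw [← hlhs, ← hrhs]
  exact hcube

/-- **Balanced normal form.** `X ↔` "for every `c > 0`, cofinally in `n`, `S_n` realizes `⟨N,N,N⟩` with
`N > √(n!)·e^{-c√n}`".  A disproof may assume `|S| = |T| = |U|`. -/
theorem thresholdSubsetTriples_iff_balanced : ThresholdSubsetTriples ↔ ThresholdBalanced :=
  ⟨thresholdBalanced_of_thresholdSubsetTriples, thresholdSubsetTriples_of_thresholdBalanced⟩


/-- `X` along the scales `1/(k+1)` suffices (antitonicity in `c`). -/
theorem thresholdSubsetTriples_iff_nat :
    ThresholdSubsetTriples ↔ ∀ k : ℕ, ThresholdAt (1 / ((k : ℝ) + 1)) := by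
  refine ⟨fun h k => h _ (by positivity), fun h c hc => ?_⟩
  obtain ⟨k, hk⟩ := exists_nat_one_div_lt hc
  exact thresholdAt_anti hk.le (h k)

/-! ### §4b Shape of a witness: balanced sizes, rooted sets -/

/-- **Size window.** In a TPP triple beating scale `c`, every set has size in
`(√(n!)·e^{-c√n}, √(n!)·e^{c√n})`: lower bound from `|S||T||U| ≤ min·n!`, upper bound from packing
`|S||T| ≤ n!` against the lower bound for the partner.  Hosts of order `≤ √(n!)e^{-c√n}` (e.g. Young
subgroups `S_b^{n/b}` with `b = O(√n)`, order `√(n!)e^{-Ω(n)}`) can contain no set of a witness. -/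
theorem card_window_of_beats {c : ℝ} {n : ℕ} {S T U : Finset (Equiv.Perm (Fin n))}
    (hTPP : TripleProductProperty S T U) (hB : Beats c n S T U) :
    Real.sqrt (n.factorial : ℝ) * Real.exp (-(c * Real.sqrt (n : ℝ))) < S.card ∧
      (S.card : ℝ) < Real.sqrt (n.factorial : ℝ) * Real.exp (c * Real.sqrt (n : ℝ)) := by
  unfold Beats at hB
  have hprod : 0 < S.card * T.card * U.card := by
    have h0 : (0 : ℝ) < ((S.card * T.card * U.card : ℕ) : ℝ) := lt_of_le_of_lt (by positivity) hB
    exact_mod_cast h0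
  have hS0 : S.card ≠ 0 := fun h0 => by simp [h0] at hprod
  have hT0 : T.card ≠ 0 := fun h0 => by simp [h0] at hprod
  have hU0 : U.card ≠ 0 := fun h0 => by simp [h0] at hprod
  obtain ⟨hP1, hP2, -⟩ := tpp_perm_card_mul_card_le_factorial hTPP hS0 hT0 hU0
  have hF : (0 : ℝ) < (n.factorial : ℝ) := by exact_mod_cast Nat.factorial_pos n
  set F : ℝ := (n.factorial : ℝ) with hFdef
  set s : ℝ := Real.sqrt (n : ℝ) with hsdef
  have hrpow : F ^ ((3 : ℝ) / 2) = F * Real.sqrt F := by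
    rw [Real.rpow_div_two_eq_sqrt _ hF.le, Real.rpow_ofNat, pow_succ, Real.sq_sqrt hF.le]
  have hsqF : Real.sqrt F * Real.sqrt F = F := Real.mul_self_sqrt hF.le
  have hsqF0 : 0 < Real.sqrt F := Real.sqrt_pos.2 hF
  have hee : Real.exp (-(c * s)) * Real.exp (c * s) = 1 := by
    rw [← Real.exp_add, neg_add_cancel, Real.exp_zero]
  -- lower bound for |S|: F^{3/2} e^{-cs} < |S| (|T||U|) ≤ |S| F
  have hlowS : Real.sqrt F * Real.exp (-(c * s)) < S.card := by
    have h1 : F * (Real.sqrt F * Real.exp (-(c * s))) < F * S.card :=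
      calc F * (Real.sqrt F * Real.exp (-(c * s))) = F ^ ((3 : ℝ) / 2) * Real.exp (-(c * s)) := by
            rw [hrpow, mul_assoc]
        _ < ((S.card * T.card * U.card : ℕ) : ℝ) := hB
        _ = (S.card : ℝ) * ((T.card * U.card : ℕ) : ℝ) := by push_cast; ring
        _ ≤ (S.card : ℝ) * F := by
            refine mul_le_mul_of_nonneg_left ?_ (Nat.cast_nonneg _)
            rw [hFdef]; exact_mod_cast hP2
        _ = F * S.card := mul_comm _ _
    exact lt_of_mul_lt_mul_left h1 hF.le
  -- lower bound for |T| (same argument on the rotated triple's packing `|U||S| ≤ n!`)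
  have hlowT : Real.sqrt F * Real.exp (-(c * s)) < T.card := by
    obtain ⟨-, -, hP3⟩ := tpp_perm_card_mul_card_le_factorial hTPP hS0 hT0 hU0
    have h1 : F * (Real.sqrt F * Real.exp (-(c * s))) < F * T.card :=
      calc F * (Real.sqrt F * Real.exp (-(c * s))) = F ^ ((3 : ℝ) / 2) * Real.exp (-(c * s)) := by
            rw [hrpow, mul_assoc]
        _ < ((S.card * T.card * U.card : ℕ) : ℝ) := hB
        _ = (T.card : ℝ) * ((U.card * S.card : ℕ) : ℝ) := by push_cast; ring
        _ ≤ (T.card : ℝ) * F := by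
            refine mul_le_mul_of_nonneg_left ?_ (Nat.cast_nonneg _)
            rw [hFdef]; exact_mod_cast hP3
        _ = F * T.card := mul_comm _ _
    exact lt_of_mul_lt_mul_left h1 hF.le
  refine ⟨hlowS, ?_⟩
  -- upper bound: |S||T| ≤ F and |T| > √F e^{-cs}
  have hT0' : (0 : ℝ) < T.card := lt_of_le_of_lt (by positivity) hlowT
  have hST : (S.card : ℝ) * T.card ≤ F := by rw [hFdef]; exact_mod_cast hP1
  by_contra hge
  rw [not_lt] at hge
  have h2 : Real.sqrt F * Real.exp (c * s) * (Real.sqrt F * Real.exp (-(c * s))) <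
      (S.card : ℝ) * T.card := by
    calc Real.sqrt F * Real.exp (c * s) * (Real.sqrt F * Real.exp (-(c * s)))
        < Real.sqrt F * Real.exp (c * s) * T.card := mul_lt_mul_of_pos_left hlowT (by positivity)
      _ ≤ (S.card : ℝ) * T.card := mul_le_mul_of_nonneg_right hge hT0'.le
  have h3 : Real.sqrt F * Real.exp (c * s) * (Real.sqrt F * Real.exp (-(c * s))) = F := by
    calc Real.sqrt F * Real.exp (c * s) * (Real.sqrt F * Real.exp (-(c * s)))
        = (Real.sqrt F * Real.sqrt F) * (Real.exp (-(c * s)) * Real.exp (c * s)) := by ring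
      _ = F := by rw [hsqF, hee, mul_one]
  linarith

/-- `X` with the witnesses normalised to contain the identity (`1 ∈ S ∩ T ∩ U`). -/
def ThresholdRooted : Prop :=
  ∀ c : ℝ, 0 < c → ∀ n₀ : ℕ, ∃ n ≥ n₀, ∃ S T U : Finset (Equiv.Perm (Fin n)),
    (1 ∈ S ∧ 1 ∈ T ∧ 1 ∈ U) ∧ TripleProductProperty S T U ∧ Beats c n S T U

/-- **Rooted normal form**: `X ↔ ThresholdRooted` (right-translate each set by the inverse of one of
its elements; the TPP is invariant under independent right translations,
`tripleProductProperty_image_mul_right_iff`, and cardinalities are unchanged).  Together with §4 a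
disproof may assume `1 ∈ S ∩ T ∩ U` (and, separately, `|S| = |T| = |U|`). -/
theorem thresholdSubsetTriples_iff_rooted : ThresholdSubsetTriples ↔ ThresholdRooted := by
  refine ⟨fun h c hc n₀ => ?_, fun h c hc n₀ => ?_⟩
  · obtain ⟨n, hn, S, T, U, hTPP, hB⟩ := h c hc n₀
    have hprod : 0 < S.card * T.card * U.card := by
      have h0 : (0 : ℝ) < ((S.card * T.card * U.card : ℕ) : ℝ) := lt_of_le_of_lt (by positivity) hB
      exact_mod_cast h0
    obtain ⟨s₀, hs₀⟩ : S.Nonempty :=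
      Finset.card_pos.1 (Nat.pos_of_ne_zero fun h0 => by simp [h0] at hprod)
    obtain ⟨t₀, ht₀⟩ : T.Nonempty :=
      Finset.card_pos.1 (Nat.pos_of_ne_zero fun h0 => by simp [h0] at hprod)
    obtain ⟨u₀, hu₀⟩ : U.Nonempty :=
      Finset.card_pos.1 (Nat.pos_of_ne_zero fun h0 => by simp [h0] at hprod)
    refine ⟨n, hn, S.image (· * s₀⁻¹), T.image (· * t₀⁻¹), U.image (· * u₀⁻¹), ⟨?_, ?_, ?_⟩,
      (tripleProductProperty_image_mul_right_iff S T U _ _ _).2 hTPP, ?_⟩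
    · exact Finset.mem_image.2 ⟨s₀, hs₀, mul_inv_cancel s₀⟩
    · exact Finset.mem_image.2 ⟨t₀, ht₀, mul_inv_cancel t₀⟩
    · exact Finset.mem_image.2 ⟨u₀, hu₀, mul_inv_cancel u₀⟩
    · unfold Beats
      rwa [Finset.card_image_of_injective _ (mul_left_injective _),
        Finset.card_image_of_injective _ (mul_left_injective _),
        Finset.card_image_of_injective _ (mul_left_injective _)]
  · obtain ⟨n, hn, S, T, U, -, hTPP, hB⟩ := h c hc n₀
    exact ⟨n, hn, S, T, U, hTPP, hB⟩

/-! ## §5 Pairwise information is void: pairwise-trivial triples DO reach the threshold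

Any refutation of `X` must use the genuinely three-fold condition: with the TPP weakened to its three
two-set consequences (`PairwiseTPP`), the threshold statement HOLDS (`thresholdSubsetTriplesPairwise_holds`),
witnessed by the rooted stabilisers `K_a = C(μ_a) ∩ Stab(0)` of the perfect matchings `{x, a - x}` of
`ℤ/n`, `a = 1, 3, 5`, `n ≡ 2 (mod 4)`: pairwise trivial (fixed-point propagation along the Hamiltonian
cycles `M_a ∪ M_b`), each of order `≥ |C(μ_a)|/n = 2^m m!/n` (`n = 2m`), so
`(n!)^{3/2} ≤ n³·|K_1||K_3||K_5|` — polynomial slack, which beats `e^{-c√n}` for every `c > 0`.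
The same construction PROVES the sibling route's support item
`SnThresholdCensus.PairwiseTrivialAtThreshold` (stmt-MatrixMultiplication-5541, `C = 3`):
`pairwiseTrivialAtThreshold_proof` below (positive statement of another route — attached to that item as a
candidate proof; a prover lands it).  And the configuration is NOT itself a witness for `X`:
`rootedTriple_not_tpp` — `(2, n-1) · (2, n-1)(1, 4) · (1, 4) = 1` with `(2,n-1) ∈ K_1`,
`(2,n-1)(1,4) ∈ K_3`, `(1,4) ∈ K_5` violates the three-fold condition at every `n ≥ 6`
(matched pairs may be swapped, `swap_mul_reflPerm_comm`, and exchanged, `swap_swap_mul_reflPerm_comm`). -/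

section Pairwise

open Fin.CommRing

variable {n : ℕ} [NeZero n]

/-- The matching involution `x ↦ a - x` of `ℤ/n = Fin n` (perfect matching `{x, a - x}` for `a` odd,
`n` even). -/
def reflPerm (n : ℕ) [NeZero n] (a : ℕ) : Equiv.Perm (Fin n) := Equiv.subLeft (a : Fin n)

/-- `μ_a x = a - x`. -/
@[simp] theorem reflPerm_apply (a : ℕ) (x : Fin n) : reflPerm n a x = (a : Fin n) - x := rfl

/-- `μ_a` is an involution. -/
theorem reflPerm_mul_self (a : ℕ) : reflPerm n a * reflPerm n a = 1 := by
  ext x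
  simp [Equiv.Perm.mul_apply, sub_sub_cancel]

/-- For `n` even and `a` odd, `x ↦ a - x` has no fixed point. -/
theorem reflPerm_ne_self (hn : 2 ∣ n) {a : ℕ} (ha : Odd a) (x : Fin n) : reflPerm n a x ≠ x := by
  intro h
  rw [reflPerm_apply, sub_eq_iff_eq_add] at h
  have hv := congrArg Fin.val h
  rw [Fin.val_natCast, Fin.val_add] at hv
  have h2 : (a % n) % 2 = ((x.val + x.val) % n) % 2 := by rw [hv]
  rw [Nat.mod_mod_of_dvd _ hn, Nat.mod_mod_of_dvd _ hn] at h2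
  obtain ⟨r, hr⟩ := ha
  omega

/-- If `σ` commutes with `μ` and fixes `x`, it fixes `μ x`. -/
theorem apply_eq_of_commute {α : Type*} {σ μ : Equiv.Perm α} (h : σ * μ = μ * σ) {x : α}
    (hx : σ x = x) : σ (μ x) = μ x := by
  have := congrArg (fun τ : Equiv.Perm α => τ x) h
  simp only [Equiv.Perm.mul_apply] at this
  rw [this, hx]

/-- Covering lemma: for `n ≡ 2 (mod 4)`, a property of `Fin n` holding at `0`, stable under `x ↦ x + 4`
and under one reflection `x ↦ a - x` with `a` odd, holds everywhere (`4ℤ + {0, 2} =` evens since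
`4·(n+2)/4 ≡ 2`, and odd `= a -` even). -/
theorem forall_of_stable (hn : n % 4 = 2) (P : Fin n → Prop) (h0 : P 0)
    (h4 : ∀ x, P x → P (x + 4)) {a : ℕ} (ha : Odd a) (hrefl : ∀ x, P x → P ((a : Fin n) - x)) :
    ∀ x, P x := by
  have hmul4 : ∀ j : ℕ, P ((4 * j : ℕ) : Fin n) := by
    intro j
    induction j with
    | zero => simpa using h0
    | succ j ih =>
      have h := h4 _ ih
      convert h using 1
      push_cast
      ring
  have h2 : P (2 : Fin n) := by
    have h := hmul4 ((n + 2) / 4)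
    have hdiv : 4 * ((n + 2) / 4) = n + 2 := by omega
    rw [hdiv] at h
    convert h using 1
    push_cast
    rw [Fin.natCast_self, zero_add]
  have hmul4' : ∀ j : ℕ, P ((4 * j + 2 : ℕ) : Fin n) := by
    intro j
    induction j with
    | zero => simpa using h2
    | succ j ih =>
      have h := h4 _ ih
      convert h using 1
      push_cast
      ring
  have heven : ∀ e : ℕ, P ((2 * e : ℕ) : Fin n) := by
    intro e
    obtain ⟨j, rfl | rfl⟩ := Nat.even_or_odd' e
    · convert hmul4 j using 2
      ring
    · convert hmul4' j using 2
      ring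
  intro x
  obtain ⟨k, hk | hk⟩ := Nat.even_or_odd' x.val
  · have hx : x = ((2 * k : ℕ) : Fin n) := by rw [← hk, Fin.cast_val_eq_self]
    rw [hx]
    exact heven k
  · obtain ⟨r, hr⟩ := ha
    have hx : x = ((2 * k + 1 : ℕ) : Fin n) := by rw [← hk, Fin.cast_val_eq_self]
    have hkn : k ≤ r + n := by have := x.isLt; omega
    rw [← sub_sub_cancel (a : Fin n) x]
    apply hrefl
    have hax : (a : Fin n) - x = ((2 * (r + n - k) : ℕ) : Fin n) := by
      rw [hx, hr]
      push_cast [Nat.cast_sub hkn]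
      rw [Fin.natCast_self]
      ring
    rw [hax]
    exact heven _

/-- **Fixed-point propagation (the dihedral lemma).** For `n ≡ 2 (mod 4)`, odd `a` and
`b = a + 2` or `b = a + 4`: a permutation commuting with both reflections `x ↦ a - x`, `x ↦ b - x`
and fixing `0` is the identity (its fixed set is stable under `x ↦ x + 4` and `x ↦ a - x`). -/
theorem eq_one_of_commute_of_fix (hn : n % 4 = 2) {a b : ℕ} (ha : Odd a) (hb : b = a + 2 ∨ b = a + 4)
    {σ : Equiv.Perm (Fin n)} (hca : σ * reflPerm n a = reflPerm n a * σ)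
    (hcb : σ * reflPerm n b = reflPerm n b * σ) (h0 : σ 0 = 0) : σ = 1 := by
  have hall : ∀ x, σ x = x := by
    refine forall_of_stable hn (fun x => σ x = x) h0 ?_ ha ?_
    · intro x hx
      rcases hb with rfl | rfl
      · have h1 := apply_eq_of_commute hcb (apply_eq_of_commute hca
          (apply_eq_of_commute hcb (apply_eq_of_commute hca hx)))
        simp only [reflPerm_apply] at h1
        convert h1 using 2 <;> push_cast <;> ring
      · have h1 := apply_eq_of_commute hcb (apply_eq_of_commute hca hx)
        simp only [reflPerm_apply] at h1
        convert h1 using 2 <;> push_cast <;> ring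
    · intro x hx
      simpa only [reflPerm_apply] using apply_eq_of_commute hca hx
  ext x
  simp [hall x]

/-- The **rooted matching stabiliser** `K_a = C(μ_a) ∩ Stab(0)`: permutations preserving the perfect
matching `{x, a - x}` of `ℤ/n` and fixing the point `0`. -/
def rootedStab (n : ℕ) [NeZero n] (a : ℕ) : Subgroup (Equiv.Perm (Fin n)) :=
  Subgroup.centralizer {reflPerm n a} ⊓ MulAction.stabilizer (Equiv.Perm (Fin n)) (0 : Fin n)

/-- Membership in `K_a`: commute with `μ_a` and fix `0`. -/
theorem mem_rootedStab {a : ℕ} {σ : Equiv.Perm (Fin n)} :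
    σ ∈ rootedStab n a ↔ σ * reflPerm n a = reflPerm n a * σ ∧ σ 0 = 0 := by
  rw [rootedStab, Subgroup.mem_inf, Subgroup.mem_centralizer_singleton_iff,
    MulAction.mem_stabilizer_iff, Equiv.Perm.smul_def]

/-- Two rooted stabilisers of matchings at odd offsets `a`, `a + 2` / `a + 4` meet trivially. -/
theorem rootedStab_inf_eq_bot (hn : n % 4 = 2) {a b : ℕ} (ha : Odd a) (hb : b = a + 2 ∨ b = a + 4) :
    rootedStab n a ⊓ rootedStab n b = ⊥ := by
  refine (Subgroup.eq_bot_iff_forall _).2 fun σ hσ => ?_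
  obtain ⟨hσa, hσb⟩ := Subgroup.mem_inf.1 hσ
  rw [mem_rootedStab] at hσa hσb
  exact eq_one_of_commute_of_fix hn ha hb hσa.1 hσb.1 hσa.2

/-- Commutation with `μ_a` is the functional equation `σ (a - z) = a - σ z`. -/
theorem mul_reflPerm_comm_of {a : ℕ} {σ : Equiv.Perm (Fin n)}
    (h : ∀ z, σ ((a : Fin n) - z) = (a : Fin n) - σ z) : σ * reflPerm n a = reflPerm n a * σ := by
  ext z
  simp only [Equiv.Perm.mul_apply, reflPerm_apply]
  rw [h z]

/-- A matched pair `{x, y}` (`x + y = a`) may be swapped inside `C(μ_a)`. -/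
theorem swap_mul_reflPerm_comm {a : ℕ} {x y : Fin n} (hxy : x + y = (a : Fin n)) :
    Equiv.swap x y * reflPerm n a = reflPerm n a * Equiv.swap x y := by
  have hax : (a : Fin n) - x = y := by rw [← hxy]; ring
  have hay : (a : Fin n) - y = x := by rw [← hxy]; ring
  refine mul_reflPerm_comm_of fun z => ?_
  rcases eq_or_ne z x with rfl | hzx
  · rw [hax, Equiv.swap_apply_left, Equiv.swap_apply_right, hay]
  rcases eq_or_ne z y with rfl | hzy
  · rw [hay, Equiv.swap_apply_right, Equiv.swap_apply_left, hax]
  have h1 : (a : Fin n) - z ≠ x := fun h => hzy (by rw [← hax, ← h, sub_sub_cancel])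
  have h2 : (a : Fin n) - z ≠ y := fun h => hzx (by rw [← hay, ← h, sub_sub_cancel])
  rw [Equiv.swap_apply_of_ne_of_ne h1 h2, Equiv.swap_apply_of_ne_of_ne hzx hzy]

/-- Two matched pairs `{x, x'}`, `{y, y'}` (`x + x' = y + y' = a`, four distinct points) may be
exchanged inside `C(μ_a)`: `(x y)(x' y')` commutes with `μ_a`. -/
theorem swap_swap_mul_reflPerm_comm {a : ℕ} {x y x' y' : Fin n} (hx : x + x' = (a : Fin n))
    (hy : y + y' = (a : Fin n)) (hxy : x ≠ y) (hxx' : x ≠ x') (hxy' : x ≠ y') (hyx' : y ≠ x')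
    (hyy' : y ≠ y') (hx'y' : x' ≠ y') :
    (Equiv.swap x y * Equiv.swap x' y') * reflPerm n a =
      reflPerm n a * (Equiv.swap x y * Equiv.swap x' y') := by
  have hax : (a : Fin n) - x = x' := by rw [← hx]; ring
  have hax' : (a : Fin n) - x' = x := by rw [← hx]; ring
  have hay : (a : Fin n) - y = y' := by rw [← hy]; ring
  have hay' : (a : Fin n) - y' = y := by rw [← hy]; ring
  set σ : Equiv.Perm (Fin n) := Equiv.swap x y * Equiv.swap x' y' with hσ
  have eval : ∀ w, σ w = Equiv.swap x y (Equiv.swap x' y' w) := fun w => rfl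
  have σx : σ x = y := by
    rw [eval, Equiv.swap_apply_of_ne_of_ne hxx' hxy', Equiv.swap_apply_left]
  have σy : σ y = x := by
    rw [eval, Equiv.swap_apply_of_ne_of_ne hyx' hyy', Equiv.swap_apply_right]
  have σx' : σ x' = y' := by
    rw [eval, Equiv.swap_apply_left, Equiv.swap_apply_of_ne_of_ne hxy'.symm hyy'.symm]
  have σy' : σ y' = x' := by
    rw [eval, Equiv.swap_apply_right, Equiv.swap_apply_of_ne_of_ne hxx'.symm hyx'.symm]
  have σz : ∀ z, z ≠ x → z ≠ y → z ≠ x' → z ≠ y' → σ z = z := by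
    intro z h1 h2 h3 h4
    rw [eval, Equiv.swap_apply_of_ne_of_ne h3 h4, Equiv.swap_apply_of_ne_of_ne h1 h2]
  refine mul_reflPerm_comm_of fun z => ?_
  rcases eq_or_ne z x with rfl | h1
  · rw [hax, σx', σx, hay]
  rcases eq_or_ne z y with rfl | h2
  · rw [hay, σy', σy, hax]
  rcases eq_or_ne z x' with rfl | h3
  · rw [hax', σx, σx', hay']
  rcases eq_or_ne z y' with rfl | h4
  · rw [hay', σy, σy', hax']
  have g1 : (a : Fin n) - z ≠ x := fun h => h3 (by rw [← hax, ← h, sub_sub_cancel])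
  have g2 : (a : Fin n) - z ≠ y := fun h => h4 (by rw [← hay, ← h, sub_sub_cancel])
  have g3 : (a : Fin n) - z ≠ x' := fun h => h1 (by rw [← hax', ← h, sub_sub_cancel])
  have g4 : (a : Fin n) - z ≠ y' := fun h => h2 (by rw [← hay', ← h, sub_sub_cancel])
  rw [σz _ g1 g2 g3 g4, σz _ h1 h2 h3 h4]

/-- **The rooted triple itself violates the TPP** (`n ≡ 2 mod 4`, `n ≥ 6`): with `x = 2`, `y = n - 1`
(an `M_1`-pair), `x' = 1 = 3 - x`, `y' = 4 = 3 - y` (an `M_5`-pair), the elements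
`σ₁ = (x y) ∈ K_1`, `σ₃ = (x y)(x' y') ∈ K_3`, `σ₅ = (x' y') ∈ K_5` satisfy `σ₁ σ₃ σ₅ = 1`, `σ₁ ≠ 1`. -/
theorem rootedTriple_not_tpp (hn6 : 6 ≤ n) (S₁ S₃ S₅ : Finset (Equiv.Perm (Fin n)))
    (h₁ : ∀ σ, σ ∈ rootedStab n 1 → σ ∈ S₁) (h₃ : ∀ σ, σ ∈ rootedStab n 3 → σ ∈ S₃)
    (h₅ : ∀ σ, σ ∈ rootedStab n 5 → σ ∈ S₅) :
    ¬ TripleProductProperty S₁ S₃ S₅ := by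
  intro hT
  -- the four points
  set x : Fin n := ((2 : ℕ) : Fin n) with hx
  set y : Fin n := ((n - 1 : ℕ) : Fin n) with hy
  set x' : Fin n := ((1 : ℕ) : Fin n) with hx'
  set y' : Fin n := ((4 : ℕ) : Fin n) with hy'
  have vx : x.val = 2 := by rw [hx, Fin.val_natCast]; exact Nat.mod_eq_of_lt (by omega)
  have vy : y.val = n - 1 := by rw [hy, Fin.val_natCast]; exact Nat.mod_eq_of_lt (by omega)
  have vx' : x'.val = 1 := by rw [hx', Fin.val_natCast]; exact Nat.mod_eq_of_lt (by omega)
  have vy' : y'.val = 4 := by rw [hy', Fin.val_natCast]; exact Nat.mod_eq_of_lt (by omega)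
  have v0 : (0 : Fin n).val = 0 := rfl
  have hxy : x ≠ y := fun h => by have := congrArg Fin.val h; omega
  have hxx' : x ≠ x' := fun h => by have := congrArg Fin.val h; omega
  have hxy' : x ≠ y' := fun h => by have := congrArg Fin.val h; omega
  have hyx' : y ≠ x' := fun h => by have := congrArg Fin.val h; omega
  have hyy' : y ≠ y' := fun h => by have := congrArg Fin.val h; omega
  have hx'y' : x' ≠ y' := fun h => by have := congrArg Fin.val h; omega
  have h0x : (0 : Fin n) ≠ x := fun h => by have := congrArg Fin.val h; omega
  have h0y : (0 : Fin n) ≠ y := fun h => by have := congrArg Fin.val h; omega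
  have h0x' : (0 : Fin n) ≠ x' := fun h => by have := congrArg Fin.val h; omega
  have h0y' : (0 : Fin n) ≠ y' := fun h => by have := congrArg Fin.val h; omega
  -- the sums
  have hn1 : 1 ≤ n := by omega
  have sum1 : x + y = ((1 : ℕ) : Fin n) := by
    rw [hx, hy, ← Nat.cast_add, show 2 + (n - 1) = n + 1 by omega, Nat.cast_add, Fin.natCast_self,
      zero_add]
  have sum5 : x' + y' = ((5 : ℕ) : Fin n) := by rw [hx', hy', ← Nat.cast_add]
  have sum3x : x + x' = ((3 : ℕ) : Fin n) := by rw [hx, hx', ← Nat.cast_add]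
  have sum3y : y + y' = ((3 : ℕ) : Fin n) := by
    rw [hy, hy', ← Nat.cast_add, show n - 1 + 4 = n + 3 by omega, Nat.cast_add, Fin.natCast_self,
      zero_add]
  -- the three elements
  set σ₁ : Equiv.Perm (Fin n) := Equiv.swap x y
  set σ₅ : Equiv.Perm (Fin n) := Equiv.swap x' y'
  set σ₃ : Equiv.Perm (Fin n) := Equiv.swap x y * Equiv.swap x' y'
  have m₁ : σ₁ ∈ rootedStab n 1 :=
    mem_rootedStab.2 ⟨swap_mul_reflPerm_comm sum1, Equiv.swap_apply_of_ne_of_ne h0x h0y⟩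
  have m₅ : σ₅ ∈ rootedStab n 5 :=
    mem_rootedStab.2 ⟨swap_mul_reflPerm_comm sum5, Equiv.swap_apply_of_ne_of_ne h0x' h0y'⟩
  have m₃ : σ₃ ∈ rootedStab n 3 := by
    refine mem_rootedStab.2 ⟨swap_swap_mul_reflPerm_comm sum3x sum3y hxy hxx' hxy' hyx' hyy' hx'y', ?_⟩
    show Equiv.swap x y (Equiv.swap x' y' 0) = 0
    rw [Equiv.swap_apply_of_ne_of_ne h0x' h0y', Equiv.swap_apply_of_ne_of_ne h0x h0y]
  have one₁ : (1 : Equiv.Perm (Fin n)) ∈ S₁ := h₁ 1 (rootedStab n 1).one_mem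
  have one₃ : (1 : Equiv.Perm (Fin n)) ∈ S₃ := h₃ 1 (rootedStab n 3).one_mem
  have one₅ : (1 : Equiv.Perm (Fin n)) ∈ S₅ := h₅ 1 (rootedStab n 5).one_mem
  have rel : σ₁ * 1⁻¹ * (σ₃ * 1⁻¹) * (σ₅ * 1⁻¹) = 1 := by
    simp only [inv_one, mul_one]
    show Equiv.swap x y * (Equiv.swap x y * Equiv.swap x' y') * Equiv.swap x' y' = 1
    rw [← mul_assoc, Equiv.swap_mul_self, one_mul, Equiv.swap_mul_self]
  have key := hT σ₁ (h₁ _ m₁) 1 one₁ σ₃ (h₃ _ m₃) 1 one₃ σ₅ (h₅ _ m₅) 1 one₅ rel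
  have : σ₁ = 1 := key.1
  rw [Equiv.Perm.one_def, Equiv.swap_eq_refl_iff] at this
  exact hxy this


/-- The rooted triple `K_1, K_3, K_5` as `Finset`s is NOT a TPP triple (`n ≡ 2 mod 4`, `n ≥ 6`): the
pairwise-perfect configuration of `thresholdSubsetTriplesPairwise_holds` fails the three-fold condition
at every `n`; whether a sub-triple of index `e^{o(√n)}` has the TPP is exactly the open constructive crux
`HyperoctahedralThreshold` (10883) / its negation inside `HyperoctahedralSubsets` (8305). -/
theorem rootedTriple_filter_not_tpp (hn6 : 6 ≤ n) [DecidablePred (· ∈ rootedStab n 1)]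
    [DecidablePred (· ∈ rootedStab n 3)] [DecidablePred (· ∈ rootedStab n 5)] :
    ¬ TripleProductProperty (Finset.univ.filter (· ∈ rootedStab n 1))
      (Finset.univ.filter (· ∈ rootedStab n 3)) (Finset.univ.filter (· ∈ rootedStab n 5)) :=
  rootedTriple_not_tpp hn6 _ _ _ (fun σ h => by simpa using h) (fun σ h => by simpa using h)
    (fun σ h => by simpa using h)

/-- Orbit–stabiliser as an inequality, relative to a subgroup: for `C ≤ G` acting on a finite `X`,
`|C| ≤ |X| · |C ⊓ Stab_G(x)|`. -/
theorem card_le_card_mul_card_inf_stabilizer {G X : Type*} [Group G] [MulAction G X] [Finite G]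
    [Finite X] (C : Subgroup G) (x : X) :
    Nat.card C ≤ Nat.card X * Nat.card ↥(C ⊓ MulAction.stabilizer G x) := by
  set S : Subgroup C := MulAction.stabilizer C x with hS
  have hidx : S.index = Nat.card (MulAction.orbit C x) := MulAction.index_stabilizer C x
  have horb : Nat.card (MulAction.orbit C x) ≤ Nat.card X := Finite.card_subtype_le _
  have hmul : Nat.card S * S.index = Nat.card C := Subgroup.card_mul_index S
  have hSeq : S = (C ⊓ MulAction.stabilizer G x).subgroupOf C := by
    ext g
    simp [hS, MulAction.mem_stabilizer_iff, Subgroup.mem_subgroupOf, Subgroup.smul_def]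
  have hcardS : Nat.card S = Nat.card ↥(C ⊓ MulAction.stabilizer G x) := by
    rw [hSeq]
    exact Nat.card_congr (Subgroup.subgroupOfEquivOfLe inf_le_left).toEquiv
  calc Nat.card C = Nat.card S * S.index := hmul.symm
    _ ≤ Nat.card S * Nat.card X := by rw [hidx]; exact Nat.mul_le_mul_left _ horb
    _ = Nat.card X * Nat.card ↥(C ⊓ MulAction.stabilizer G x) := by rw [hcardS, mul_comm]

/-- `(2m)! ≤ (2^m·m!)²` (central binomial coefficient `≤ 4^m`). -/
theorem factorial_two_mul_le_sq (m : ℕ) : (2 * m).factorial ≤ (2 ^ m * m.factorial) ^ 2 := by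
  have hcb : Nat.centralBinom m * (m.factorial * m.factorial) = (2 * m).factorial := by
    have h := Nat.choose_mul_factorial_mul_factorial (n := 2 * m) (k := m) (by omega)
    rw [show 2 * m - m = m by omega] at h
    rw [Nat.centralBinom_eq_two_mul_choose, ← h, mul_assoc]
  have h22 : (2 : ℕ) ^ m * 2 ^ m = 4 ^ m := by rw [← mul_pow]; norm_num
  calc (2 * m).factorial = Nat.centralBinom m * (m.factorial * m.factorial) := hcb.symm
    _ ≤ 4 ^ m * (m.factorial * m.factorial) :=
        Nat.mul_le_mul_right _ (Nat.centralBinom_le_four_pow m)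
    _ = (2 ^ m * m.factorial) ^ 2 := by rw [← h22]; ring

/-- **Size of a rooted stabiliser**: for `n` even and `a` odd, `(n · |K_a|)² ≥ n!`
(`|C(μ_a)| = 2^m m!` with `n = 2m`, orbit–stabiliser `n·|K_a| ≥ |C(μ_a)|`, and `(2^m m!)² ≥ (2m)!`). -/
theorem factorial_le_sq_mul_card_rootedStab (hn : 2 ∣ n) {a : ℕ} (ha : Odd a) :
    n.factorial ≤ (n * Nat.card (rootedStab n a)) ^ 2 := by
  have hn0 : 0 < n := Nat.pos_of_ne_zero (NeZero.ne n)
  obtain ⟨m, hnm, hcard⟩ := natCard_centralizer_fpf_involution hn0 (reflPerm_mul_self a)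
    (reflPerm_ne_self hn ha)
  have hle : Nat.card ↥(Subgroup.centralizer ({reflPerm n a} : Set (Equiv.Perm (Fin n)))) ≤
      n * Nat.card (rootedStab n a) := by
    have h := card_le_card_mul_card_inf_stabilizer
      (Subgroup.centralizer ({reflPerm n a} : Set (Equiv.Perm (Fin n)))) (0 : Fin n)
    simpa only [rootedStab, Nat.card_eq_fintype_card (α := Fin n), Fintype.card_fin] using h
  rw [hcard] at hle
  calc n.factorial = (2 * m).factorial := by rw [hnm]
    _ ≤ (2 ^ m * m.factorial) ^ 2 := factorial_two_mul_le_sq m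
    _ ≤ (n * Nat.card (rootedStab n a)) ^ 2 := Nat.pow_le_pow_left hle 2

/-- The three rooted stabilisers of the matchings `{x, 1-x}`, `{x, 3-x}`, `{x, 5-x}`. -/
def rootedTriple (n : ℕ) [NeZero n] : Fin 3 → Subgroup (Equiv.Perm (Fin n)) :=
  ![rootedStab n 1, rootedStab n 3, rootedStab n 5]

/-- The three rooted stabilisers `K_1, K_3, K_5` meet pairwise trivially (`n ≡ 2 mod 4`). -/
theorem rootedTriple_pairwise (hn : n % 4 = 2) :
    ∀ i j : Fin 3, i ≠ j → rootedTriple n i ⊓ rootedTriple n j = ⊥ := by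
  have h13 : rootedStab n 1 ⊓ rootedStab n 3 = ⊥ :=
    rootedStab_inf_eq_bot hn ⟨0, rfl⟩ (Or.inl rfl)
  have h35 : rootedStab n 3 ⊓ rootedStab n 5 = ⊥ :=
    rootedStab_inf_eq_bot hn ⟨1, rfl⟩ (Or.inl rfl)
  have h15 : rootedStab n 1 ⊓ rootedStab n 5 = ⊥ :=
    rootedStab_inf_eq_bot hn ⟨0, rfl⟩ (Or.inr rfl)
  intro i j hij
  fin_cases i <;> fin_cases j <;>
    simp only [rootedTriple, Matrix.cons_val_zero, Matrix.cons_val_one, Matrix.head_cons,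
      Matrix.cons_val_two, Matrix.tail_cons, Fin.isValue, Fin.mk_one, Fin.zero_eta,
      Fin.reduceFinMk] at hij ⊢
  all_goals first
    | exact absurd rfl hij
    | exact h13 | exact h35 | exact h15
    | (rw [inf_comm]; first | exact h13 | exact h35 | exact h15)

/-- **The volume inequality**: for `n ≡ 2 (mod 4)`,
`(n!)^{3/2} ≤ n³ · |K_1||K_3||K_5|`. -/
theorem factorial_rpow_le_rootedTriple (hn : n % 4 = 2) :
    (n.factorial : ℝ) ^ ((3 : ℝ) / 2) ≤ (n : ℝ) ^ (3 : ℝ) *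
      ((Nat.card (rootedTriple n 0) * Nat.card (rootedTriple n 1) * Nat.card (rootedTriple n 2) : ℕ) : ℝ) := by
  have h2 : 2 ∣ n := by omega
  have e1 := factorial_le_sq_mul_card_rootedStab (n := n) h2 (a := 1) ⟨0, rfl⟩
  have e3 := factorial_le_sq_mul_card_rootedStab (n := n) h2 (a := 3) ⟨1, rfl⟩
  have e5 := factorial_le_sq_mul_card_rootedStab (n := n) h2 (a := 5) ⟨2, rfl⟩
  -- in ℕ: (n!)³ ≤ (n³ V)²
  set V : ℕ := Nat.card (rootedTriple n 0) * Nat.card (rootedTriple n 1) * Nat.card (rootedTriple n 2)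
    with hV
  have hV' : V = Nat.card (rootedStab n 1) * Nat.card (rootedStab n 3) * Nat.card (rootedStab n 5) := by
    simp [hV, rootedTriple]
  have hnat : n.factorial ^ 3 ≤ (n ^ 3 * V) ^ 2 := by
    calc n.factorial ^ 3 = n.factorial * n.factorial * n.factorial := by ring
      _ ≤ (n * Nat.card (rootedStab n 1)) ^ 2 * (n * Nat.card (rootedStab n 3)) ^ 2 *
            (n * Nat.card (rootedStab n 5)) ^ 2 := Nat.mul_le_mul (Nat.mul_le_mul e1 e3) e5
      _ = (n ^ 3 * V) ^ 2 := by rw [hV']; ring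
  have hreal : ((n.factorial : ℝ)) ^ 3 ≤ (((n ^ 3 * V : ℕ) : ℝ)) ^ 2 := by exact_mod_cast hnat
  have hF : (0 : ℝ) ≤ (n.factorial : ℝ) := Nat.cast_nonneg _
  calc (n.factorial : ℝ) ^ ((3 : ℝ) / 2) = Real.sqrt ((n.factorial : ℝ) ^ 3) := by
        rw [Real.sqrt_eq_rpow, ← Real.rpow_natCast, ← Real.rpow_mul hF]
        norm_num
    _ ≤ Real.sqrt ((((n ^ 3 * V : ℕ) : ℝ)) ^ 2) := Real.sqrt_le_sqrt hreal
    _ = ((n ^ 3 * V : ℕ) : ℝ) := Real.sqrt_sq (Nat.cast_nonneg _)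
    _ = (n : ℝ) ^ (3 : ℝ) * (V : ℝ) := by
        rw [show (3 : ℝ) = ((3 : ℕ) : ℝ) by norm_num, Real.rpow_natCast]
        push_cast
        ring

/-- **Item `SnThresholdCensus.PairwiseTrivialAtThreshold` (stmt-MatrixMultiplication-5541) holds**, with
`C = 3` and `n = 4n₀ + 2`: pairwise-trivially-intersecting subgroup triples reach the threshold up to `n³`. -/
theorem pairwiseTrivialAtThreshold_proof :
    Summit.MatrixMultiplication.MatrixMultiplication.Theses.SnThresholdCensus.PairwiseTrivialAtThreshold := by
  refine ⟨3, fun n₀ => ⟨4 * n₀ + 2, by omega, ?_⟩⟩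
  haveI : NeZero (4 * n₀ + 2) := ⟨by omega⟩
  have hn : (4 * n₀ + 2) % 4 = 2 := by omega
  exact ⟨rootedTriple (4 * n₀ + 2), rootedTriple_pairwise hn, factorial_rpow_le_rootedTriple hn⟩

end Pairwise

section PairwiseThreshold

/-- **Pairwise TPP**: the three two-set consequences `q_X q_Y = 1 ⇒ q_X = q_Y = 1` of the TPP. -/
def PairwiseTPP {G : Type*} [Group G] (S T U : Finset G) : Prop :=
  (∀ s ∈ S, ∀ s' ∈ S, ∀ t ∈ T, ∀ t' ∈ T, s * s'⁻¹ * (t * t'⁻¹) = 1 → s = s' ∧ t = t') ∧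
  (∀ t ∈ T, ∀ t' ∈ T, ∀ u ∈ U, ∀ u' ∈ U, t * t'⁻¹ * (u * u'⁻¹) = 1 → t = t' ∧ u = u') ∧
  (∀ s ∈ S, ∀ s' ∈ S, ∀ u ∈ U, ∀ u' ∈ U, s * s'⁻¹ * (u * u'⁻¹) = 1 → s = s' ∧ u = u')

/-- The TPP implies the pairwise TPP as soon as the three sets are non-empty. -/
theorem pairwiseTPP_of_tripleProductProperty {G : Type*} [Group G] {S T U : Finset G}
    (h : TripleProductProperty S T U) (hS : S.Nonempty) (hT : T.Nonempty) (hU : U.Nonempty) :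
    PairwiseTPP S T U := by
  obtain ⟨s₀, hs₀⟩ := hS
  obtain ⟨t₀, ht₀⟩ := hT
  obtain ⟨u₀, hu₀⟩ := hU
  refine ⟨fun s hs s' hs' t ht t' ht' he => ?_, fun t ht t' ht' u hu u' hu' he => ?_,
    fun s hs s' hs' u hu u' hu' he => ?_⟩
  · have h1 := h s hs s' hs' t ht t' ht' u₀ hu₀ u₀ hu₀ (by rw [mul_inv_cancel, mul_one]; exact he)
    exact ⟨h1.1, h1.2.1⟩
  · have h1 := h s₀ hs₀ s₀ hs₀ t ht t' ht' u hu u' hu' (by rw [mul_inv_cancel, one_mul]; exact he)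
    exact ⟨h1.2.1, h1.2.2⟩
  · have h1 := h s hs s' hs' t₀ ht₀ t₀ ht₀ u hu u' hu' (by rw [mul_inv_cancel, mul_one]; exact he)
    exact ⟨h1.1, h1.2.2⟩

/-- Two subgroups with trivial meet, as `Finset`s, satisfy the two-set condition. -/
theorem pairCond_of_inf_eq_bot {G : Type*} [Group G] [Fintype G] (H K : Subgroup G)
    [DecidablePred (· ∈ H)] [DecidablePred (· ∈ K)] (h : H ⊓ K = ⊥) :
    ∀ s ∈ Finset.univ.filter (· ∈ H), ∀ s' ∈ Finset.univ.filter (· ∈ H),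
      ∀ t ∈ Finset.univ.filter (· ∈ K), ∀ t' ∈ Finset.univ.filter (· ∈ K),
        s * s'⁻¹ * (t * t'⁻¹) = 1 → s = s' ∧ t = t' := by
  intro s hs s' hs' t ht t' ht' he
  simp only [Finset.mem_filter, Finset.mem_univ, true_and] at hs hs' ht ht'
  have hq : s * s'⁻¹ = (t * t'⁻¹)⁻¹ := eq_inv_of_mul_eq_one_left he
  have hH : s * s'⁻¹ ∈ H := H.mul_mem hs (H.inv_mem hs')
  have hK : s * s'⁻¹ ∈ K := by rw [hq]; exact K.inv_mem (K.mul_mem ht (K.inv_mem ht'))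
  have h1 : s * s'⁻¹ = 1 := by
    have hmem : s * s'⁻¹ ∈ H ⊓ K := Subgroup.mem_inf.2 ⟨hH, hK⟩
    rw [h] at hmem
    exact Subgroup.mem_bot.1 hmem
  refine ⟨mul_inv_eq_one.1 h1, ?_⟩
  rw [h1] at hq
  have h2 : t * t'⁻¹ = 1 := inv_eq_one.1 hq.symm
  exact mul_inv_eq_one.1 h2

/-- `X` with the TPP weakened to the pairwise TPP. -/
def ThresholdSubsetTriplesPairwise : Prop :=
  ∀ c : ℝ, 0 < c → ∀ n₀ : ℕ, ∃ n ≥ n₀, ∃ S T U : Finset (Equiv.Perm (Fin n)),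
    PairwiseTPP S T U ∧ Beats c n S T U

/-- **The pairwise weakening of `X` is TRUE** (rooted hyperoctahedral stabilisers `K_1, K_3, K_5` at
`n = 4k + 2`): `(n!)^{3/2} ≤ n³|K_1||K_3||K_5|` and `n³ < e^{c√n}` eventually.  Hence a proof of `¬X`
cannot be a pairwise/packing argument: it must use the three-fold condition. -/
theorem thresholdSubsetTriplesPairwise_holds : ThresholdSubsetTriplesPairwise := by
  intro c hc n₀
  classical
  obtain ⟨n₁, -, hev⟩ := eventually_dlog_le_sqrt c 3 hc
  obtain ⟨n, hn, hn4, hn₁⟩ : ∃ n : ℕ, n₀ ≤ n ∧ n % 4 = 2 ∧ n₁ ≤ n :=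
    ⟨4 * max n₀ n₁ + 2, by omega, by omega, by omega⟩
  haveI : NeZero n := ⟨by omega⟩
  refine ⟨n, hn, Finset.univ.filter (· ∈ rootedStab n 1), Finset.univ.filter (· ∈ rootedStab n 3),
    Finset.univ.filter (· ∈ rootedStab n 5), ?_, ?_⟩
  · exact ⟨pairCond_of_inf_eq_bot _ _ (rootedStab_inf_eq_bot hn4 ⟨0, rfl⟩ (Or.inl rfl)),
      pairCond_of_inf_eq_bot _ _ (rootedStab_inf_eq_bot hn4 ⟨1, rfl⟩ (Or.inl rfl)),
      pairCond_of_inf_eq_bot _ _ (rootedStab_inf_eq_bot hn4 ⟨0, rfl⟩ (Or.inr rfl))⟩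
  · unfold Beats
    rw [card_filter_mem_subgroup (rootedStab n 1), card_filter_mem_subgroup (rootedStab n 3),
      card_filter_mem_subgroup (rootedStab n 5)]
    have hvol := factorial_rpow_le_rootedTriple hn4
    simp only [rootedTriple, Matrix.cons_val_zero, Matrix.cons_val_one, Matrix.head_cons,
      Matrix.cons_val_two, Matrix.tail_cons] at hvol
    set V : ℝ := ((Nat.card (rootedStab n 1) * Nat.card (rootedStab n 3) *
      Nat.card (rootedStab n 5) : ℕ) : ℝ) with hV
    have hV0 : 0 < V := by
      rw [hV]
      have h1 : 0 < Nat.card (rootedStab n 1) := Nat.card_pos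
      have h3 : 0 < Nat.card (rootedStab n 3) := Nat.card_pos
      have h5 : 0 < Nat.card (rootedStab n 5) := Nat.card_pos
      positivity
    have hn0 : (0 : ℝ) < n := by
      have : 0 < n := by omega
      exact_mod_cast this
    have hlog : 3 * Real.log n < c * Real.sqrt n := by linarith [hev n hn₁]
    have hn3 : (n : ℝ) ^ (3 : ℝ) < Real.exp (c * Real.sqrt n) := by
      rw [Real.rpow_def_of_pos hn0]
      exact Real.exp_lt_exp.2 (by linarith)
    have hexp0 : 0 < Real.exp (-(c * Real.sqrt n)) := Real.exp_pos _
    have hsmall : (n : ℝ) ^ (3 : ℝ) * Real.exp (-(c * Real.sqrt n)) < 1 := by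
      calc (n : ℝ) ^ (3 : ℝ) * Real.exp (-(c * Real.sqrt n))
          < Real.exp (c * Real.sqrt n) * Real.exp (-(c * Real.sqrt n)) :=
            mul_lt_mul_of_pos_right hn3 hexp0
        _ = 1 := by rw [← Real.exp_add, add_neg_cancel, Real.exp_zero]
    calc (n.factorial : ℝ) ^ ((3 : ℝ) / 2) * Real.exp (-(c * Real.sqrt n))
        ≤ (n : ℝ) ^ (3 : ℝ) * V * Real.exp (-(c * Real.sqrt n)) :=
          mul_le_mul_of_nonneg_right hvol hexp0.le
      _ = V * ((n : ℝ) ^ (3 : ℝ) * Real.exp (-(c * Real.sqrt n))) := by ring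
      _ < V * 1 := mul_lt_mul_of_pos_left hsmall hV0
      _ = V := mul_one _

/-- For the record: the TPP at the threshold implies the pairwise TPP (threshold triples are non-empty),
so `X → ThresholdSubsetTriplesPairwise`; the converse is exactly what fails to be provable. -/
theorem thresholdSubsetTriplesPairwise_of_thresholdSubsetTriples (h : ThresholdSubsetTriples) :
    ThresholdSubsetTriplesPairwise := by
  intro c hc n₀
  obtain ⟨n, hn, S, T, U, hTPP, hlt⟩ := h c hc n₀
  have hprod : 0 < S.card * T.card * U.card := by
    have h0 : (0 : ℝ) < ((S.card * T.card * U.card : ℕ) : ℝ) := lt_of_le_of_lt (by positivity) hlt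
    exact_mod_cast h0
  have hS : S.Nonempty := Finset.card_pos.1 (Nat.pos_of_ne_zero fun h0 => by simp [h0] at hprod)
  have hT : T.Nonempty := Finset.card_pos.1 (Nat.pos_of_ne_zero fun h0 => by simp [h0] at hprod)
  have hU : U.Nonempty := Finset.card_pos.1 (Nat.pos_of_ne_zero fun h0 => by simp [h0] at hprod)
  exact ⟨n, hn, S, T, U, pairwiseTPP_of_tripleProductProperty hTPP hS hT hU, hlt⟩

end PairwiseThreshold

/-! ### §5c Computed evidence (local, seconds; scripts `compute/rooted_subtriple.py`, `compute/one_set_thinning.py`)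

How much of the rooted triple `K_1, K_3, K_5` survives as a TPP SUB-triple?  (Relevant to the constructive
crux `HyperoctahedralThreshold` and its negation inside `HyperoctahedralSubsets`; recorded here because §5
shows this configuration is exactly where pairwise arguments stop.)
* `n = 6` (`|K| = 8`, `|K|³ = 512`): EXHAUSTIVE maximum TPP sub-triple volume `= 256 = 4·8·8` (half of one set
  removed); `|K_1 ∩ K_5K_3| = 4`.
* `n = 10` (`|K| = 384`, `|K|³ ≈ 5.7·10⁷`, `n! ≈ 3.6·10⁶`): `|F| = |K_1 ∩ K_5K_3| = 148` (density `0.385`,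
  against `≈ 15.6` for random sets of these sizes — the other seat's `H(5) = 148`); ONE-SET THINNING (keep
  `K_3, K_5` whole, shrink `K_1` to `S_1` with `S_1S_1⁻¹ ∩ F = {1}`, an independent set in the Cayley graph
  `Cay(K_1, F ∖ 1)` of degree `203`): greedy best `|S_1| = 12`, volume `12·384² ≈ 1.77·10⁶ ≈ 0.49·n!`, i.e.
  a fraction `0.031` of `|K|³` (vs `0.5` at `n = 6`).  So the naive repair of the knife-edge triple decays
  fast (`1/2, 1/32, …`); balanced three-set thinning at `n = 10, 14` is the informative next computation
  (ILP / local search, a kit job — not run here; the 8305/10883 seats own it).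
-/

/-! ## §6 The `e^{O(√n)} ≪ √(n!)` bookkeeping and the degenerate symmetric ansätze -/

/-- **Asymptotic bookkeeping.** `e^{c√n} ≤ √(n!)` for all large `n` (crudely: `n! ≥ k^k`, `k = ⌊n/2⌋`,
and `c√n ≤ (n-1)/4` once `√n ≥ 4c+1`).  Used to discharge every "`|S| ≤ 1` cannot beat the threshold"
step below. -/
theorem exp_sqrt_le_sqrt_factorial {c : ℝ} (hc : 0 ≤ c) :
    ∃ n₀ : ℕ, ∀ n : ℕ, n₀ ≤ n → Real.exp (c * Real.sqrt n) ≤ Real.sqrt (n.factorial : ℝ) := by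
  refine ⟨max 6 ⌈(4 * c + 1) ^ 2⌉₊, fun n hn => ?_⟩
  have hn6 : 6 ≤ n := (le_max_left _ _).trans hn
  have hnc : (4 * c + 1) ^ 2 ≤ (n : ℝ) :=
    (Nat.le_ceil _).trans (by exact_mod_cast (le_max_right _ _).trans hn)
  have hs : 4 * c + 1 ≤ Real.sqrt n := by
    rw [show (4 * c + 1) = Real.sqrt ((4 * c + 1) ^ 2) from (Real.sqrt_sq (by linarith)).symm]
    exact Real.sqrt_le_sqrt hnc
  have hs1 : 1 ≤ Real.sqrt n := by linarith
  have hss : Real.sqrt n * Real.sqrt n = n := Real.mul_self_sqrt (Nat.cast_nonneg n)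
  have h1 : 4 * c * Real.sqrt n + 1 ≤ n := by nlinarith [hs, hs1, hss]
  set k := n / 2 with hk
  have hk3 : 3 ≤ k := by omega
  have h2k : 2 * k ≤ n := by omega
  have hn2k : n ≤ 2 * k + 1 := by omega
  have hfac : k ^ k ≤ n.factorial := by
    have h := Nat.factorial_mul_pow_sub_le_factorial (show k ≤ 2 * k by omega)
    rw [show 2 * k - k = k by omega] at h
    calc k ^ k ≤ k.factorial * k ^ k := Nat.le_mul_of_pos_left _ (Nat.factorial_pos k)
      _ ≤ (2 * k).factorial := h
      _ ≤ n.factorial := Nat.factorial_le h2k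
  have hk0 : (0 : ℝ) < k := by exact_mod_cast (by omega : 0 < k)
  have hlogk : 1 ≤ Real.log k := by
    rw [Real.le_log_iff_exp_le hk0]
    have he : Real.exp 1 < 3 := lt_trans Real.exp_one_lt_d9 (by norm_num)
    have h3k : (3 : ℝ) ≤ k := by exact_mod_cast hk3
    linarith
  have hlogfac : (k : ℝ) * Real.log k ≤ Real.log (n.factorial : ℝ) := by
    rw [← Real.log_pow]
    refine Real.log_le_log (by positivity) ?_
    exact_mod_cast hfac
  have hklow : ((n : ℝ) - 1) / 2 ≤ k := by
    have : (n : ℝ) ≤ 2 * k + 1 := by exact_mod_cast hn2k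
    linarith
  have hmain : c * Real.sqrt n ≤ Real.log (n.factorial : ℝ) / 2 := by
    have hk1 : (k : ℝ) ≤ k * Real.log k := by nlinarith [hlogk, hk0]
    linarith [h1, hklow, hk1, hlogfac]
  have hF0 : (0 : ℝ) < (n.factorial : ℝ) := by exact_mod_cast Nat.factorial_pos n
  calc Real.exp (c * Real.sqrt n) ≤ Real.exp (Real.log (n.factorial : ℝ) / 2) :=
        Real.exp_le_exp.2 hmain
    _ = Real.sqrt (n.factorial : ℝ) := by
        rw [Real.sqrt_eq_rpow, Real.rpow_def_of_pos hF0]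
        congr 1
        ring

/-- Consequence: at scale `c > 0` the threshold `(n!)^{3/2}·e^{-c√n}` eventually exceeds `n!`, so a
triple of volume `≤ n!` (e.g. one set of size `≤ 1`) is never a witness for large `n`. -/
theorem factorial_le_threshold {c : ℝ} (hc : 0 ≤ c) :
    ∃ n₀ : ℕ, ∀ n : ℕ, n₀ ≤ n →
      (n.factorial : ℝ) ≤ (n.factorial : ℝ) ^ ((3 : ℝ) / 2) * Real.exp (-(c * Real.sqrt n)) := by
  obtain ⟨n₀, h⟩ := exp_sqrt_le_sqrt_factorial hc
  refine ⟨n₀, fun n hn => ?_⟩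
  have hF : (0 : ℝ) < (n.factorial : ℝ) := by exact_mod_cast Nat.factorial_pos n
  set F : ℝ := (n.factorial : ℝ) with hFdef
  have hrpow : F ^ ((3 : ℝ) / 2) = F * Real.sqrt F := by
    rw [Real.rpow_div_two_eq_sqrt _ hF.le, Real.rpow_ofNat, pow_succ, Real.sq_sqrt hF.le]
  have he : Real.exp (c * Real.sqrt n) * Real.exp (-(c * Real.sqrt n)) = 1 := by
    rw [← Real.exp_add, add_neg_cancel, Real.exp_zero]
  have h1 : F * 1 ≤ F * (Real.sqrt F * Real.exp (-(c * Real.sqrt n))) := by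
    refine mul_le_mul_of_nonneg_left ?_ hF.le
    calc (1 : ℝ) = Real.exp (c * Real.sqrt n) * Real.exp (-(c * Real.sqrt n)) := he.symm
      _ ≤ Real.sqrt F * Real.exp (-(c * Real.sqrt n)) :=
          mul_le_mul_of_nonneg_right (h n hn) (Real.exp_pos _).le
  calc F = F * 1 := (mul_one F).symm
    _ ≤ F * (Real.sqrt F * Real.exp (-(c * Real.sqrt n))) := h1
    _ = F ^ ((3 : ℝ) / 2) * Real.exp (-(c * Real.sqrt n)) := by rw [hrpow, mul_assoc]

/-- **Pair rule (T4 of the lead's catalogue, any group).** In a TPP triple with `U` non-empty the quotient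
sets `Q(S) = S·S⁻¹` and `Q(T)` meet only in `1`. -/
theorem quot_eq_one_of_tpp {G : Type*} [Group G] {S T U : Finset G}
    (h : TripleProductProperty S T U) (hU : U.Nonempty) {s s' t t' : G} (hs : s ∈ S) (hs' : s' ∈ S)
    (ht : t ∈ T) (ht' : t' ∈ T) (hq : s * s'⁻¹ = t * t'⁻¹) : s = s' ∧ t = t' := by
  obtain ⟨u, hu⟩ := hU
  have key := h s hs s' hs' t' ht' t ht u hu u hu (by
    rw [hq]; group)
  exact ⟨key.1, key.2.1.symm⟩

/-- **Two equal sets are void.** `TPP(S, S, U)` with `U ≠ ∅` forces `|S| ≤ 1` (`Q(S) ∩ Q(S) = {1}`). -/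
theorem card_le_one_of_tpp_self {G : Type*} [Group G] {S U : Finset G}
    (h : TripleProductProperty S S U) (hU : U.Nonempty) : S.card ≤ 1 := by
  rw [Finset.card_le_one]
  intro s hs s' hs'
  exact (quot_eq_one_of_tpp h hU hs hs' hs hs' rfl).1

/-- `X` restricted to triples whose first two sets coincide (the `g = 1` case of every translate /
triality ansatz `T = gS`). -/
def ThresholdTwoEqualSets : Prop :=
  ∀ c : ℝ, 0 < c → ∀ n₀ : ℕ, ∃ n ≥ n₀, ∃ S U : Finset (Equiv.Perm (Fin n)),
    TripleProductProperty S S U ∧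
      (n.factorial : ℝ) ^ ((3 : ℝ) / 2) * Real.exp (-(c * Real.sqrt (n : ℝ))) <
        ((S.card * S.card * U.card : ℕ) : ℝ)

/-- **REFUTED degenerate ansatz**: with two equal sets the threshold is unreachable at EVERY scale
(`|S| ≤ 1`, so the volume is `≤ |U| ≤ n! ≤ (n!)^{3/2}e^{-c√n}` for large `n`). -/
theorem not_thresholdTwoEqualSets : ¬ ThresholdTwoEqualSets := by
  intro h
  obtain ⟨n₀, hn₀⟩ := factorial_le_threshold (show (0 : ℝ) ≤ 1 by norm_num)
  obtain ⟨n, hn, S, U, hTPP, hlt⟩ := h 1 one_pos n₀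
  have hprod : 0 < S.card * S.card * U.card := by
    have h0 : (0 : ℝ) < ((S.card * S.card * U.card : ℕ) : ℝ) := lt_of_le_of_lt (by positivity) hlt
    exact_mod_cast h0
  have hU : U.Nonempty := Finset.card_pos.1 (Nat.pos_of_ne_zero fun h0 => by simp [h0] at hprod)
  have hS1 : S.card ≤ 1 := card_le_one_of_tpp_self hTPP hU
  have hvol : S.card * S.card * U.card ≤ n.factorial := by
    have hUc : U.card ≤ n.factorial := by
      calc U.card ≤ (Finset.univ : Finset (Equiv.Perm (Fin n))).card := Finset.card_le_univ U
        _ = n.factorial := by rw [Finset.card_univ, Fintype.card_perm, Fintype.card_fin]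
    calc S.card * S.card * U.card ≤ 1 * 1 * U.card :=
          Nat.mul_le_mul (Nat.mul_le_mul hS1 hS1) le_rfl
      _ = U.card := by ring
      _ ≤ n.factorial := hUc
  have hvol' : ((S.card * S.card * U.card : ℕ) : ℝ) ≤ (n.factorial : ℝ) := by exact_mod_cast hvol
  have h1 := hn₀ n hn
  linarith

/-! ## §7 Line `interleaved-subsignature-ascent` (picked by lead c1-0, declared DEAD at `stub_design`;
`Lines/interleaved-subsignature-ascent-dead.md`) — load-bearing analysis of `stub_design` -/

section Interleaved

/-- `stub_design` with its `LevelCondition` conjunct dropped (everything else verbatim). -/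
def StubDesignWithoutLevel : Prop :=
  ∀ c : ℝ, 0 < c → ∀ n₀ : ℕ, ∃ n ≥ n₀, ∃ DA DB DC : Fin (n + 1) → Finset (Fin (n + 1)),
    IsDirectionSystem DA ∧ IsDirectionSystem DB ∧ IsDirectionSystem DC ∧
    ((n + 1).factorial : ℝ) ^ ((3 : ℝ) / 2) * Real.exp (-(c * Real.sqrt ((n + 1 : ℕ) : ℝ))) <
      ((∏ k : Fin (n + 1), ((DA k).card * (DB k).card * (DC k).card) : ℕ) : ℝ)

/-- The FULL direction system `D k = {0, …, k}` (chain class `= S_{n+1}`). -/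
theorem isDirectionSystem_Iic (n : ℕ) : IsDirectionSystem (fun k : Fin (n + 1) => Finset.Iic k) :=
  fun _ _ hd => Finset.mem_Iic.1 hd

/-- Its level volumes multiply to `(n+1)!`. -/
theorem prod_card_Iic (n : ℕ) : ∏ k : Fin (n + 1), (Finset.Iic k).card = (n + 1).factorial := by
  simp_rw [Fin.card_Iic]
  rw [Fin.prod_univ_eq_prod_range (fun i => i + 1) (n + 1), Finset.prod_range_add_one_eq_factorial]

/-- **`LevelCondition` is the only load-bearing conjunct of `stub_design` besides `0 < c`**: without it the
three FULL systems (`S_D = S_{n+1}`, level volumes `((n+1)!)³`) satisfy everything at every scale. -/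
theorem stubDesignWithoutLevel_holds : StubDesignWithoutLevel := by
  intro c hc n₀
  refine ⟨n₀, le_rfl, fun k => Finset.Iic k, fun k => Finset.Iic k, fun k => Finset.Iic k,
    isDirectionSystem_Iic n₀, isDirectionSystem_Iic n₀, isDirectionSystem_Iic n₀, ?_⟩
  have hprod : (∏ k : Fin (n₀ + 1), ((Finset.Iic k).card * (Finset.Iic k).card * (Finset.Iic k).card))
      = (n₀ + 1).factorial ^ 3 := by
    rw [← prod_card_Iic n₀, ← Finset.prod_pow]
    refine Finset.prod_congr rfl fun k _ => by ring
  rw [hprod]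
  set F : ℝ := ((n₀ + 1).factorial : ℝ) with hF
  have hF1 : (1 : ℝ) ≤ F := by rw [hF]; exact_mod_cast Nat.succ_le_of_lt (Nat.factorial_pos _)
  have hexp : Real.exp (-(c * Real.sqrt ((n₀ + 1 : ℕ) : ℝ))) < 1 := by
    rw [Real.exp_lt_one_iff, neg_lt_zero]
    exact mul_pos hc (Real.sqrt_pos.2 (by positivity))
  have hpow : F ^ ((3 : ℝ) / 2) ≤ F ^ (3 : ℝ) := Real.rpow_le_rpow_of_exponent_le hF1 (by norm_num)
  calc F ^ ((3 : ℝ) / 2) * Real.exp (-(c * Real.sqrt ((n₀ + 1 : ℕ) : ℝ)))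
      < F ^ ((3 : ℝ) / 2) * 1 := mul_lt_mul_of_pos_left hexp (by positivity)
    _ ≤ F ^ (3 : ℝ) := by rw [mul_one]; exact hpow
    _ = (((n₀ + 1).factorial ^ 3 : ℕ) : ℝ) := by
        rw [show (3 : ℝ) = ((3 : ℕ) : ℝ) by norm_num, Real.rpow_natCast]
        push_cast
        rfl

variable {α : Type*} [DecidableEq α]

/-- **Level rule (L), pair `(1,2)`.**  Under `LevelCondition` (all three lower sets non-empty, `E₃ ≠ ∅`)
two direction sets share AT MOST ONE direction: `x ≠ y ∈ E₁ ∩ E₂` gives the non-trivial relation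
`(x t)(y t)·(y t)(x t)·(e t)(e t) = 1` with trivial lower quotients. -/
theorem levelCondition_eq_of_mem_inter₁₂ {t : α} {E₁ E₂ E₃ : Finset α} {L₁ L₂ L₃ : Finset (Equiv.Perm α)}
    (h : LevelCondition t E₁ E₂ E₃ L₁ L₂ L₃) (h₃ : E₃.Nonempty) (hL₁ : L₁.Nonempty) (hL₂ : L₂.Nonempty)
    (hL₃ : L₃.Nonempty) {x y : α} (hx₁ : x ∈ E₁) (hx₂ : x ∈ E₂) (hy₁ : y ∈ E₁) (hy₂ : y ∈ E₂) :
    x = y := by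
  obtain ⟨e, he⟩ := h₃
  obtain ⟨a, ha⟩ := hL₁
  obtain ⟨b, hb⟩ := hL₂
  obtain ⟨c, hc⟩ := hL₃
  have key := h x hx₁ y hy₁ y hy₂ x hx₂ e he e he a ha a ha b hb b hb c hc c hc (by
    simp only [mul_inv_cancel, mul_one, Equiv.Perm.one_apply, Equiv.mul_swap_mul_self,
      Equiv.swap_mul_self])
  exact key.1.1

/-- Level rule (L), pair `(2,3)`. -/
theorem levelCondition_eq_of_mem_inter₂₃ {t : α} {E₁ E₂ E₃ : Finset α} {L₁ L₂ L₃ : Finset (Equiv.Perm α)}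
    (h : LevelCondition t E₁ E₂ E₃ L₁ L₂ L₃) (h₁ : E₁.Nonempty) (hL₁ : L₁.Nonempty) (hL₂ : L₂.Nonempty)
    (hL₃ : L₃.Nonempty) {x y : α} (hx₂ : x ∈ E₂) (hx₃ : x ∈ E₃) (hy₂ : y ∈ E₂) (hy₃ : y ∈ E₃) :
    x = y := by
  obtain ⟨e, he⟩ := h₁
  obtain ⟨a, ha⟩ := hL₁
  obtain ⟨b, hb⟩ := hL₂
  obtain ⟨c, hc⟩ := hL₃
  have key := h e he e he x hx₂ y hy₂ y hy₃ x hx₃ a ha a ha b hb b hb c hc c hc (by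
    simp only [mul_inv_cancel, one_mul, mul_one, Equiv.Perm.one_apply, Equiv.mul_swap_mul_self,
      Equiv.swap_mul_self])
  exact key.2.1.1

/-- Level rule (L), pair `(1,3)`. -/
theorem levelCondition_eq_of_mem_inter₁₃ {t : α} {E₁ E₂ E₃ : Finset α} {L₁ L₂ L₃ : Finset (Equiv.Perm α)}
    (h : LevelCondition t E₁ E₂ E₃ L₁ L₂ L₃) (h₂ : E₂.Nonempty) (hL₁ : L₁.Nonempty) (hL₂ : L₂.Nonempty)
    (hL₃ : L₃.Nonempty) {x y : α} (hx₁ : x ∈ E₁) (hx₃ : x ∈ E₃) (hy₁ : y ∈ E₁) (hy₃ : y ∈ E₃) :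
    x = y := by
  obtain ⟨e, he⟩ := h₂
  obtain ⟨a, ha⟩ := hL₁
  obtain ⟨b, hb⟩ := hL₂
  obtain ⟨c, hc⟩ := hL₃
  have key := h x hx₁ y hy₁ e he e he y hy₃ x hx₃ a ha a ha b hb b hb c hc c hc (by
    simp only [mul_inv_cancel, mul_one, Equiv.Perm.one_apply, Equiv.mul_swap_mul_self,
      Equiv.swap_mul_self])
  exact key.1.1

/-- **Level rule (L), counted**: the three direction sets of a level passing `LevelCondition` have
pairwise intersections of size `≤ 1`, hence `|E₁| + |E₂| + |E₃| ≤ |E₁ ∪ E₂ ∪ E₃| + 3` — at level `k` of a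
direction system (`E_i ⊆ {0,…,k}`) at most `k + 4` letters in total, level volume `≤ ((k+4)/3)³`.  This is
the whole level-local content; it does not bound `GM(η_k)` away from `1` (level capacity `≫ (k+1)^{3/2}`,
lead census c3b §4). -/
theorem levelCondition_card_add_card_add_card_le {t : α} {E₁ E₂ E₃ : Finset α}
    {L₁ L₂ L₃ : Finset (Equiv.Perm α)} (h : LevelCondition t E₁ E₂ E₃ L₁ L₂ L₃) (h₁ : E₁.Nonempty)
    (h₂ : E₂.Nonempty) (h₃ : E₃.Nonempty) (hL₁ : L₁.Nonempty) (hL₂ : L₂.Nonempty) (hL₃ : L₃.Nonempty) :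
    E₁.card + E₂.card + E₃.card ≤ (E₁ ∪ E₂ ∪ E₃).card + 3 := by
  have h12 : (E₁ ∩ E₂).card ≤ 1 := Finset.card_le_one.2 fun x hx y hy =>
    levelCondition_eq_of_mem_inter₁₂ h h₃ hL₁ hL₂ hL₃ (Finset.mem_inter.1 hx).1 (Finset.mem_inter.1 hx).2
      (Finset.mem_inter.1 hy).1 (Finset.mem_inter.1 hy).2
  have h13 : (E₁ ∩ E₃).card ≤ 1 := Finset.card_le_one.2 fun x hx y hy =>
    levelCondition_eq_of_mem_inter₁₃ h h₂ hL₁ hL₂ hL₃ (Finset.mem_inter.1 hx).1 (Finset.mem_inter.1 hx).2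
      (Finset.mem_inter.1 hy).1 (Finset.mem_inter.1 hy).2
  have h23 : (E₂ ∩ E₃).card ≤ 1 := Finset.card_le_one.2 fun x hx y hy =>
    levelCondition_eq_of_mem_inter₂₃ h h₁ hL₁ hL₂ hL₃ (Finset.mem_inter.1 hx).1 (Finset.mem_inter.1 hx).2
      (Finset.mem_inter.1 hy).1 (Finset.mem_inter.1 hy).2
  have hA := Finset.card_union_add_card_inter E₁ E₂
  have hB := Finset.card_union_add_card_inter (E₁ ∪ E₂) E₃
  have hC : ((E₁ ∪ E₂) ∩ E₃).card ≤ 2 := by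
    calc ((E₁ ∪ E₂) ∩ E₃).card = ((E₁ ∩ E₃) ∪ (E₂ ∩ E₃)).card := by rw [Finset.union_inter_distrib_right]
      _ ≤ (E₁ ∩ E₃).card + (E₂ ∩ E₃).card := Finset.card_union_le _ _
      _ ≤ 2 := by omega
  omega

end Interleaved

/-! ## §8 Line `triality-uniquely-cubing-translate` (lead's next preference after the interleaved line
died) — what the design stub adds to `C⁺ = TrialityThreshold`, and the void twist `g = 1` -/

section TrialityLine

variable {G : Type*} [Group G] [DecidableEq G]

/-- (verbatim from the line's skeleton) `W` cubes to `1` only as `g · g · g`. -/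
def UniquelyCubing (W : Finset G) (g : G) : Prop :=
  ∀ w₁ ∈ W, ∀ w₂ ∈ W, ∀ w₃ ∈ W, w₁ * w₂ * w₃ = 1 → w₁ = g ∧ w₂ = g ∧ w₃ = g

/-- (verbatim) the translated right quotient set `Q(S)·g`. -/
def quotTranslate (S : Finset G) (g : G) : Finset G :=
  (S ×ˢ S).image fun p => p.1 * p.2⁻¹ * g

omit [DecidableEq G] in
/-- **The twist `g = 1` is void** (also any `g` for which `S` has two elements with `s s'⁻¹ g = g (s s'⁻¹)`,
the skeleton's `quot_comm_imp_eq`): `UniquelyCubing (Q(S)·1) 1` forces `|S| ≤ 1`, because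
`(s s'⁻¹)(s' s⁻¹)(s s⁻¹) = 1`. -/
theorem card_le_one_of_uniquelyCubing_one [DecidableEq G] (S : Finset G)
    (h : UniquelyCubing (quotTranslate S 1) 1) : S.card ≤ 1 := by
  rw [Finset.card_le_one]
  intro s hs s' hs'
  have hw : ∀ a ∈ S, ∀ b ∈ S, a * b⁻¹ * 1 ∈ quotTranslate S 1 :=
    fun a ha b hb => Finset.mem_image.2 ⟨(a, b), Finset.mem_product.2 ⟨ha, hb⟩, rfl⟩
  have key := (h _ (hw s hs s' hs') _ (hw s' hs' s hs) _ (hw s hs s hs) (by group)).1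
  have h1 : s * s'⁻¹ = 1 := by simpa using key
  exact mul_inv_eq_one.1 h1

/-- **No symmetry under the twist.**  If `S` is stable under conjugation by `g` (`g⁻¹ s g ∈ S` for
`s ∈ S`; e.g. a subgroup normalised by `g`, or a `g`-invariant chain class) and `Q(S)·g` is uniquely cubing,
then `|S| ≤ 1`: for `s ≠ s'` the triple `(s s'⁻¹ g) · (t t'⁻¹ g) · g` with `t = g⁻¹ s' g`, `t' = g⁻¹ s g`
multiplies to `g³ = 1`.  So a triality design is never `g`-stable — in the line's PRIMARY sub-family
(levels = `g`-orbits, `S, S^g, S^{g²}` classes of one chain) the three classes must be genuinely distinct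
direction systems. -/
theorem card_le_one_of_uniquelyCubing_of_conj_mem (S : Finset G) (g : G) (hg : g ^ 3 = 1)
    (hS : ∀ s ∈ S, g⁻¹ * s * g ∈ S) (hUC : UniquelyCubing (quotTranslate S g) g) : S.card ≤ 1 := by
  have hg3 : g * g * g = 1 := by simpa [pow_succ, mul_assoc] using hg
  rw [Finset.card_le_one]
  intro s hs s' hs'
  have hw : ∀ a ∈ S, ∀ b ∈ S, a * b⁻¹ * g ∈ quotTranslate S g :=
    fun a ha b hb => Finset.mem_image.2 ⟨(a, b), Finset.mem_product.2 ⟨ha, hb⟩, rfl⟩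
  have hgg : g ∈ quotTranslate S g := by simpa using hw s hs s hs
  have hprod : (s * s'⁻¹ * g) * (g⁻¹ * s' * g * (g⁻¹ * s * g)⁻¹ * g) * g = 1 := by
    calc (s * s'⁻¹ * g) * (g⁻¹ * s' * g * (g⁻¹ * s * g)⁻¹ * g) * g = g * g * g := by group
      _ = 1 := hg3
  have key := (hUC _ (hw s hs s' hs') _ (hw _ (hS s' hs') _ (hS s hs)) _ hgg hprod).1
  have h1 : s * s'⁻¹ = 1 := mul_right_cancel (key.trans (one_mul g).symm)
  exact mul_inv_eq_one.1 h1

/-- **Hereditary twist conjugation.**  If `Q(S)·g` is uniquely cubing and `r·B ⊆ S`, then `Q(B)·gʳ` is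
uniquely cubing for the CONJUGATE twist `gʳ = r⁻¹ g r` (`Q(rB) = r Q(B) r⁻¹ ⊆ Q(S)` and conjugation is an
automorphism).  For a chain product `S = R₀·R₁⋯R_{k-1}` this says: the tail `R₁⋯R_{k-1}` is a triality design
for EVERY twist `gʳ`, `r ∈ R₀`, simultaneously (and so on down the chain) — in particular
`Q(R₁⋯R_{k-1}) ∩ C(gʳ) = 1` for all `r ∈ R₀` (`quot_comm_imp_eq`), a pruning rule for the line's search and
the reason a large top level `R₀` taxes every lower level (lead census c2 §2, "cross-level tax"). -/
theorem uniquelyCubing_of_mul_subset (S B : Finset G) (g r : G)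
    (hUC : UniquelyCubing (quotTranslate S g) g) (hB : ∀ b ∈ B, r * b ∈ S) :
    UniquelyCubing (quotTranslate B (r⁻¹ * g * r)) (r⁻¹ * g * r) := by
  intro w₁ hw₁ w₂ hw₂ w₃ hw₃ hprod
  obtain ⟨⟨b₁, b₁'⟩, hp₁, rfl⟩ := Finset.mem_image.1 hw₁
  obtain ⟨⟨b₂, b₂'⟩, hp₂, rfl⟩ := Finset.mem_image.1 hw₂
  obtain ⟨⟨b₃, b₃'⟩, hp₃, rfl⟩ := Finset.mem_image.1 hw₃
  rw [Finset.mem_product] at hp₁ hp₂ hp₃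
  have hw : ∀ a ∈ B, ∀ b ∈ B, (r * a) * (r * b)⁻¹ * g ∈ quotTranslate S g :=
    fun a ha b hb => Finset.mem_image.2 ⟨(r * a, r * b), Finset.mem_product.2 ⟨hB a ha, hB b hb⟩, rfl⟩
  -- conjugating the relation by `r` gives a cubing triple of `Q(S)·g`
  have hrel : ((r * b₁) * (r * b₁')⁻¹ * g) * ((r * b₂) * (r * b₂')⁻¹ * g) *
      ((r * b₃) * (r * b₃')⁻¹ * g) = 1 := by
    calc ((r * b₁) * (r * b₁')⁻¹ * g) * ((r * b₂) * (r * b₂')⁻¹ * g) * ((r * b₃) * (r * b₃')⁻¹ * g)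
        = r * ((b₁ * b₁'⁻¹ * (r⁻¹ * g * r)) * (b₂ * b₂'⁻¹ * (r⁻¹ * g * r)) *
            (b₃ * b₃'⁻¹ * (r⁻¹ * g * r))) * r⁻¹ := by group
      _ = 1 := by rw [hprod]; group
  obtain ⟨h1, h2, h3⟩ := hUC _ (hw b₁ hp₁.1 b₁' hp₁.2) _ (hw b₂ hp₂.1 b₂' hp₂.2) _
    (hw b₃ hp₃.1 b₃' hp₃.2) hrel
  have key : ∀ a b : G, (r * a) * (r * b)⁻¹ * g = g → a * b⁻¹ * (r⁻¹ * g * r) = r⁻¹ * g * r := by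
    intro a b hab
    calc a * b⁻¹ * (r⁻¹ * g * r) = r⁻¹ * ((r * a) * (r * b)⁻¹ * g) * r := by group
      _ = r⁻¹ * g * r := by rw [hab]
  exact ⟨key _ _ h1, key _ _ h2, key _ _ h3⟩

/-- (verbatim) `C⁺ = TrialityThreshold`: cofinally in `n`, some `g` with `g³ = 1` and ONE set `S` with
`Q(S)·g` uniquely cubing and `|S| > √(n!)·e^{-c√n}`.  (`→ X` is the skeleton's proved `transfer_holds`;
`X → ω(ℂ) = 2` is `matrixMultiplication_of_thresholdSubsetTriples`.) -/
def TrialityThreshold : Prop :=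
  ∀ c : ℝ, 0 < c → ∀ n₀ : ℕ, ∃ n ≥ n₀, ∃ g : Equiv.Perm (Fin n), g ^ 3 = 1 ∧
    ∃ S : Finset (Equiv.Perm (Fin n)), UniquelyCubing (quotTranslate S g) g ∧
      Real.sqrt (n.factorial : ℝ) * Real.exp (-(c * Real.sqrt (n : ℝ))) < (S.card : ℝ)

/-- (verbatim signature of the registered stub `stub_trialityChainDesign`, with the tree's `chainProd`). -/
def StubTrialityChainDesign : Prop :=
  ∀ c : ℝ, 0 < c → ∀ n₀ : ℕ, ∃ n ≥ n₀, ∃ g : Equiv.Perm (Fin n), orderOf g = 3 ∧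
    ∃ k : ℕ, ∃ lvl : Fin n → Fin k,
      (∀ j : Fin k, (Finset.univ.filter fun x => lvl x = j).card ≤ 3) ∧
      ∃ R : Fin k → Finset (Equiv.Perm (Fin n)),
        (∀ j : Fin k, ∀ r ∈ R j, ∀ x : Fin n, lvl x < j → r x = x) ∧
        (∀ j : Fin k, ∀ r ∈ R j, ∀ r' ∈ R j, (∀ x : Fin n, lvl x ≤ j → r' x = r x) → r = r') ∧
        UniquelyCubing (quotTranslate (chainProd R) g) g ∧
        Real.sqrt (n.factorial : ℝ) * Real.exp (-(c * Real.sqrt (n : ℝ))) <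
          ((∏ j, (R j).card : ℕ) : ℝ)

/-- The stub with the FIBRE BOUND `|lvl⁻¹(j)| ≤ 3` dropped (everything else verbatim). -/
def StubTrialityChainDesignWithoutFibres : Prop :=
  ∀ c : ℝ, 0 < c → ∀ n₀ : ℕ, ∃ n ≥ n₀, ∃ g : Equiv.Perm (Fin n), orderOf g = 3 ∧
    ∃ k : ℕ, ∃ lvl : Fin n → Fin k,
      ∃ R : Fin k → Finset (Equiv.Perm (Fin n)),
        (∀ j : Fin k, ∀ r ∈ R j, ∀ x : Fin n, lvl x < j → r x = x) ∧
        (∀ j : Fin k, ∀ r ∈ R j, ∀ r' ∈ R j, (∀ x : Fin n, lvl x ≤ j → r' x = r x) → r = r') ∧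
        UniquelyCubing (quotTranslate (chainProd R) g) g ∧
        Real.sqrt (n.factorial : ℝ) * Real.exp (-(c * Real.sqrt (n : ℝ))) <
          ((∏ j, (R j).card : ℕ) : ℝ)

/-- Dropping a conjunct: the stub implies its fibre-free form. -/
theorem stubTrialityChainDesignWithoutFibres_of_stub (h : StubTrialityChainDesign) :
    StubTrialityChainDesignWithoutFibres := by
  intro c hc n₀
  obtain ⟨n, hn, g, hg, k, lvl, -, R, hRK, hRT, hUC, hbig⟩ := h c hc n₀
  exact ⟨n, hn, g, hg, k, lvl, R, hRK, hRT, hUC, hbig⟩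

/-- **Exact bookkeeping along the point chain** (the skeleton's glue, through the LANDED `stub_chainProductCard`,
p88812): level sets `R j ⊆ K_j = Fix{lvl < j}` that are partial transversals of `K_{j+1}` multiply
directly, `|R 0 ⋯ R (k-1)| = ∏ |R j|` — with NO use of the fibre bound. -/
theorem card_chainProd_eq {n k : ℕ} (lvl : Fin n → Fin k) (R : Fin k → Finset (Equiv.Perm (Fin n)))
    (hRK : ∀ j : Fin k, ∀ r ∈ R j, ∀ x : Fin n, lvl x < j → r x = x)
    (hRT : ∀ j : Fin k, ∀ r ∈ R j, ∀ r' ∈ R j, (∀ x : Fin n, lvl x ≤ j → r' x = r x) → r = r') :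
    (chainProd R).card = ∏ j, (R j).card := by
  let K : Fin (k + 1) → Subgroup (Equiv.Perm (Fin n)) := fun j =>
    fixingSubgroup (Equiv.Perm (Fin n)) {x : Fin n | ((lvl x : ℕ) : ℕ) < (j : ℕ)}
  have hK : Antitone K := by
    intro i j hij
    refine fixingSubgroup_antitone (Equiv.Perm (Fin n)) (Fin n) ?_
    intro x hx
    simp only [Set.mem_setOf_eq] at hx ⊢
    exact lt_of_lt_of_le hx (Fin.le_def.1 hij)
  have hRK' : ∀ j : Fin k, ∀ r ∈ R j, r ∈ K j.castSucc := by
    intro j r hr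
    rw [mem_fixingSubgroup_iff]
    intro y hy
    simp only [Set.mem_setOf_eq, Fin.val_castSucc] at hy
    rw [Equiv.Perm.smul_def]
    exact hRK j r hr y (Fin.lt_def.2 hy)
  have hRT' : ∀ j : Fin k, ∀ r ∈ R j, ∀ r' ∈ R j, r⁻¹ * r' ∈ K j.succ → r = r' := by
    intro j r hr r' hr' hmem
    rw [mem_fixingSubgroup_iff] at hmem
    refine hRT j r hr r' hr' fun x hx => ?_
    have hx' : x ∈ {x : Fin n | ((lvl x : ℕ) : ℕ) < ((j.succ : Fin (k + 1)) : ℕ)} := by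
      simp only [Set.mem_setOf_eq, Fin.val_succ]
      exact Nat.lt_succ_of_le (Fin.le_def.1 hx)
    have h1 := hmem x hx'
    rw [Equiv.Perm.smul_def, Equiv.Perm.mul_apply] at h1
    have h2 := congrArg r h1
    simpa using h2
  exact stub_chainProductCard (Equiv.Perm (Fin n)) k K R hK hRK' hRT'

/-- **Fibre-free stub `→ C⁺`.** -/
theorem trialityThreshold_of_withoutFibres (h : StubTrialityChainDesignWithoutFibres) :
    TrialityThreshold := by
  intro c hc n₀
  obtain ⟨n, hn, g, hg, k, lvl, R, hRK, hRT, hUC, hbig⟩ := h c hc n₀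
  refine ⟨n, hn, g, ?_, chainProd R, hUC, ?_⟩
  · rw [← hg]
    exact pow_orderOf_eq_one g
  · rw [card_chainProd_eq lvl R hRK hRT]
    exact hbig

/-- **`C⁺ →` fibre-free stub**: ONE level (`k = 1`, `lvl ≡ 0`, `R 0 = S`): the chain conditions are then
vacuous/automatic and `R 0 = S` is its own chain product.  (`g ≠ 1` because a threshold set has two
elements for large `n` — `card_le_one_of_uniquelyCubing_one` + `exp_sqrt_le_sqrt_factorial` — so
`g³ = 1` upgrades to `orderOf g = 3`.) -/
theorem withoutFibres_of_trialityThreshold (h : TrialityThreshold) :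
    StubTrialityChainDesignWithoutFibres := by
  intro c hc n₀
  obtain ⟨N, hN⟩ := exp_sqrt_le_sqrt_factorial hc.le
  obtain ⟨n, hn, g, hg3, S, hUC, hbig⟩ := h c hc (max n₀ N)
  have hn₀ : n₀ ≤ n := (le_max_left _ _).trans hn
  have hnN : N ≤ n := (le_max_right _ _).trans hn
  -- `|S| ≥ 2`, hence `g ≠ 1`, hence `orderOf g = 3`
  have hS2 : 1 < S.card := by
    have he : Real.exp (c * Real.sqrt n) * Real.exp (-(c * Real.sqrt n)) = 1 := by
      rw [← Real.exp_add, add_neg_cancel, Real.exp_zero]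
    have h1 : (1 : ℝ) ≤ Real.sqrt (n.factorial : ℝ) * Real.exp (-(c * Real.sqrt (n : ℝ))) := by
      calc (1 : ℝ) = Real.exp (c * Real.sqrt n) * Real.exp (-(c * Real.sqrt n)) := he.symm
        _ ≤ Real.sqrt (n.factorial : ℝ) * Real.exp (-(c * Real.sqrt (n : ℝ))) :=
            mul_le_mul_of_nonneg_right (hN n hnN) (Real.exp_pos _).le
    have h2 : (1 : ℝ) < S.card := lt_of_le_of_lt h1 hbig
    exact_mod_cast h2
  have hg1 : g ≠ 1 := by
    rintro rfl
    have := card_le_one_of_uniquelyCubing_one S hUC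
    omega
  have hord : orderOf g = 3 :=
    orderOf_eq_prime hg3 hg1
  refine ⟨n, hn₀, g, hord, 1, fun _ => 0, fun _ => S, ?_, ?_, ?_, ?_⟩
  · intro j r _ x hx
    exact absurd hx (by simp)
  · intro j r _ r' _ hagree
    exact Equiv.ext fun x => (hagree x (by simp)).symm
  · have hcp : chainProd (fun _ : Fin 1 => S) = S := by
      rw [chainProd_succ, chainProd_zero, mul_one]
    rw [hcp]
    exact hUC
  · simpa using hbig

/-- **What the design stub adds to `C⁺`.**  The fibre-free stub is EQUIVALENT to `C⁺ = TrialityThreshold`;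
so the fibre bound `|lvl⁻¹(j)| ≤ 3` (≥ n/3 genuine chain steps) is the line's only content beyond `C⁺`, and
the skeleton's glue `ThresholdSubsetTriples_of` (which discards that hypothesis) is `C⁺ → X` in costume.
`C⁺` is `X` on `ℤ/3`-translate triples — the symmetric half of BCCGU 2017 §4's open question — so no
`_false_without_fibres` theorem is available: the fibre bound is load-bearing only relative to an open
statement. -/
theorem stubWithoutFibres_iff_trialityThreshold :
    StubTrialityChainDesignWithoutFibres ↔ TrialityThreshold :=
  ⟨trialityThreshold_of_withoutFibres, withoutFibres_of_trialityThreshold⟩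

/-- The registered stub implies `C⁺`. -/
theorem trialityThreshold_of_stub (h : StubTrialityChainDesign) : TrialityThreshold :=
  trialityThreshold_of_withoutFibres (stubTrialityChainDesignWithoutFibres_of_stub h)


/-! ### §8b Fixed points of the twist are paid factorially (exact design rule for `C⁺` and the stub) -/

/-- (skeleton's DESIGN RULE 1, `quot_comm_imp_eq`, copied) under unique cubing no non-trivial quotient
`s s'⁻¹` commutes with `g`: `(q g)(q⁻¹ g) g = g³ = 1` would be a second cubing triple. -/
theorem quot_comm_imp_eq (S : Finset G) (g : G) (hg : g ^ 3 = 1)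
    (hUC : UniquelyCubing (quotTranslate S g) g) {s s' : G} (hs : s ∈ S) (hs' : s' ∈ S)
    (hcomm : s * s'⁻¹ * g = g * (s * s'⁻¹)) : s = s' := by
  have hg3 : g * g * g = 1 := by simpa [pow_succ, mul_assoc] using hg
  have hw : ∀ a ∈ S, ∀ b ∈ S, a * b⁻¹ * g ∈ quotTranslate S g :=
    fun a ha b hb => Finset.mem_image.2 ⟨(a, b), Finset.mem_product.2 ⟨ha, hb⟩, rfl⟩
  have hprod : (s * s'⁻¹ * g) * (s' * s⁻¹ * g) * (s * s⁻¹ * g) = 1 := by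
    calc (s * s'⁻¹ * g) * (s' * s⁻¹ * g) * (s * s⁻¹ * g)
        = (g * (s * s'⁻¹)) * (s' * s⁻¹ * g) * (s * s⁻¹ * g) := by rw [hcomm]
      _ = g * g * g := by group
      _ = 1 := hg3
  have key := (hUC _ (hw s hs s' hs') _ (hw s' hs' s hs) _ (hw s hs s hs) hprod).1
  have h1 : s * s'⁻¹ = 1 := mul_right_cancel (key.trans (one_mul g).symm)
  exact mul_inv_eq_one.1 h1

/-- **Centralizer packing.** Under unique cubing `(z, s) ↦ z·s` is injective on `C(g) × S`
(`z s = z' s'` makes `s' s⁻¹ = z'⁻¹ z` commute with `g`), so `|C(g)|·|S| ≤ |G|`. -/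
theorem card_comm_mul_card_le [Fintype G] (S : Finset G) (g : G) (hg : g ^ 3 = 1)
    (hUC : UniquelyCubing (quotTranslate S g) g) :
    (Finset.univ.filter fun z : G => z * g = g * z).card * S.card ≤ Fintype.card G := by
  set Z : Finset G := Finset.univ.filter fun z : G => z * g = g * z with hZ
  have hinj : Set.InjOn (fun p : G × G => p.1 * p.2) ↑(Z ×ˢ S) := by
    rintro ⟨z, s⟩ hp ⟨z', s'⟩ hp' heq
    simp only [Finset.coe_product, Set.mem_prod, Finset.mem_coe, hZ, Finset.mem_filter,
      Finset.mem_univ, true_and] at hp hp'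
    simp only at heq
    -- `s' s⁻¹ = z'⁻¹ z` commutes with `g`
    have hq : s' * s⁻¹ = z'⁻¹ * z := by
      calc s' * s⁻¹ = z'⁻¹ * (z' * s') * s⁻¹ := by group
        _ = z'⁻¹ * (z * s) * s⁻¹ := by rw [heq]
        _ = z'⁻¹ * z := by group
    have hcomm : s' * s⁻¹ * g = g * (s' * s⁻¹) := by
      rw [hq]
      calc z'⁻¹ * z * g = z'⁻¹ * (z * g) := by group
        _ = z'⁻¹ * (g * z) := by rw [hp.1]
        _ = z'⁻¹ * g * z' * (z'⁻¹ * z) := by group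
        _ = z'⁻¹ * (z' * g) * (z'⁻¹ * z) := by rw [hp'.1]; group
        _ = g * (z'⁻¹ * z) := by group
    have hss : s' = s := quot_comm_imp_eq S g hg hUC hp'.2 hp.2 hcomm
    subst hss
    have hzz : z = z' := mul_right_cancel heq
    subst hzz
    rfl
  calc Z.card * S.card = (Z ×ˢ S).card := (Finset.card_product _ _).symm
    _ = ((Z ×ˢ S).image fun p : G × G => p.1 * p.2).card := (Finset.card_image_of_injOn hinj).symm
    _ ≤ (Finset.univ : Finset G).card := Finset.card_le_univ _
    _ = Fintype.card G := Finset.card_univ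

/-- Permutations supported on the fixed points of `g` commute with `g`: `|Fix g|! ≤ |C(g)|`. -/
theorem factorial_card_fixed_le_card_comm {n : ℕ} (g : Equiv.Perm (Fin n)) :
    (Finset.univ.filter fun x : Fin n => g x = x).card.factorial ≤
      (Finset.univ.filter fun z : Equiv.Perm (Fin n) => z * g = g * z).card := by
  set F : Finset (Fin n) := Finset.univ.filter fun x : Fin n => g x = x with hF
  have hmemF : ∀ x : Fin n, x ∈ F ↔ g x = x := fun x => by simp [hF]
  have hcard : (Fintype.card (Equiv.Perm {x // x ∈ F})) = F.card.factorial := by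
    rw [Fintype.card_perm, Fintype.card_coe]
  rw [← hcard, ← Finset.card_univ, ← Finset.card_image_of_injective (Finset.univ)
    (Equiv.Perm.ofSubtype_injective (p := fun x : Fin n => x ∈ F))]
  refine Finset.card_le_card fun z hz => ?_
  obtain ⟨σ, -, rfl⟩ := Finset.mem_image.1 hz
  rw [Finset.mem_filter]
  refine ⟨Finset.mem_univ _, ?_⟩
  ext x
  rw [Equiv.Perm.mul_apply, Equiv.Perm.mul_apply]
  by_cases hx : x ∈ F
  · have hgx : g x = x := (hmemF x).1 hx
    have hy : ((σ ⟨x, hx⟩ : {x // x ∈ F}) : Fin n) ∈ F := (σ ⟨x, hx⟩).2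
    have hgy : g (σ ⟨x, hx⟩ : Fin n) = σ ⟨x, hx⟩ := (hmemF _).1 hy
    rw [hgx, Equiv.Perm.ofSubtype_apply_of_mem σ hx, hgy]
  · have hgx : g x ∉ F := by
      intro h'
      have h1 : g (g x) = g x := (hmemF _).1 h'
      exact hx ((hmemF x).2 (g.injective h1))
    rw [Equiv.Perm.ofSubtype_apply_of_not_mem σ hx, Equiv.Perm.ofSubtype_apply_of_not_mem σ hgx]

/-- **Fixed points of the twist are paid factorially.**  For `g³ = 1` and `Q(S)·g` uniquely cubing in
`S_n`: `|S| · |Fix g|! ≤ n!`.  With `|S| > √(n!)·e^{-c√n}` (any witness of `C⁺`, of `stub_trialityChainDesign`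
or of `stub_blockedHosts`) this forces `|Fix g|! < √(n!)·e^{c√n}`, i.e. `|Fix g| ≤ (1/2 + o(1))·n` from this
crude count already (the sharp class count `|S| ≤ n!/(3^k k! f!)`, skeleton r1-2, gives `f ≤ (1/4+o(1))n`);
in the PRIMARY sub-family of the triality chain line (levels = `g`-orbits) the singleton levels are exactly
`Fix g`, so at most a vanishing-entropy fraction of the chain may consist of singleton steps. -/
theorem card_mul_factorial_fixed_le {n : ℕ} (g : Equiv.Perm (Fin n)) (hg : g ^ 3 = 1)
    (S : Finset (Equiv.Perm (Fin n))) (hUC : UniquelyCubing (quotTranslate S g) g) :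
    S.card * (Finset.univ.filter fun x : Fin n => g x = x).card.factorial ≤ n.factorial := by
  have h1 := card_comm_mul_card_le S g hg hUC
  rw [Fintype.card_perm, Fintype.card_fin] at h1
  calc S.card * (Finset.univ.filter fun x : Fin n => g x = x).card.factorial
      ≤ S.card * (Finset.univ.filter fun z : Equiv.Perm (Fin n) => z * g = g * z).card :=
        Nat.mul_le_mul_left _ (factorial_card_fixed_le_card_comm g)
    _ = (Finset.univ.filter fun z : Equiv.Perm (Fin n) => z * g = g * z).card * S.card := mul_comm _ _
    _ ≤ n.factorial := h1

/-- **A twist fixing two thirds of the points cannot carry a threshold set.**  For every `c > 0`, for all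
large `n`: if `g³ = 1` fixes `f ≥ 2n/3` points and `Q(S)·g` is uniquely cubing then
`|S| ≤ n!/f! ≤ n^{n-f} ≤ n^{n/3} ≤ √(n!)·e^{-c√n}` (`card_mul_factorial_fixed_le`; `log n! ≥ n log n - n` is the tree's
`Literature.Combinatorics.Enumerative.cast_mul_log_sub_le_log_factorial`).
So in `C⁺` / `stub_trialityChainDesign` / `stub_blockedHosts` the twist must MOVE more than `n/3` points
(the skeleton's informal class count sharpens this to `(3/4 - o(1))n`): "few moved points" is a refuted
sub-family of the line's search space. -/
theorem card_le_threshold_of_fixed_ge {c : ℝ} (hc : 0 < c) :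
    ∃ n₀ : ℕ, ∀ n : ℕ, n₀ ≤ n → ∀ g : Equiv.Perm (Fin n), g ^ 3 = 1 →
      ∀ S : Finset (Equiv.Perm (Fin n)), UniquelyCubing (quotTranslate S g) g →
        2 * n ≤ 3 * (Finset.univ.filter fun x : Fin n => g x = x).card →
          (S.card : ℝ) ≤ Real.sqrt (n.factorial : ℝ) * Real.exp (-(c * Real.sqrt (n : ℝ))) := by
  refine ⟨max ⌈Real.exp 6⌉₊ ⌈4 * c ^ 2⌉₊ + 1, fun n hn g hg S hUC hfix => ?_⟩
  set f : ℕ := (Finset.univ.filter fun x : Fin n => g x = x).card with hf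
  have hn1 : 1 ≤ n := le_trans (Nat.le_add_left 1 _) hn
  have hn0 : (0 : ℝ) < n := by exact_mod_cast hn1
  have hne6 : Real.exp 6 ≤ n := (Nat.le_ceil _).trans
    (by exact_mod_cast (le_max_left _ _).trans ((Nat.le_succ _).trans hn))
  have hnc : 4 * c ^ 2 ≤ n := (Nat.le_ceil _).trans
    (by exact_mod_cast (le_max_right _ _).trans ((Nat.le_succ _).trans hn))
  have hlog6 : 6 ≤ Real.log n := (Real.le_log_iff_exp_le hn0).2 hne6
  -- `|S| ≤ n^{n-f}` in ℕ
  have hfn : f ≤ n := by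
    calc f ≤ (Finset.univ : Finset (Fin n)).card := Finset.card_filter_le _ _
      _ = n := by rw [Finset.card_univ, Fintype.card_fin]
  have hpack := card_mul_factorial_fixed_le g hg S hUC
  rw [← hf] at hpack
  have hdesc : n.factorial = f.factorial * n.descFactorial (n - f) := by
    have h := Nat.factorial_mul_descFactorial (Nat.sub_le n f)
    rw [Nat.sub_sub_self hfn] at h
    exact h.symm
  have hS : S.card ≤ n ^ (n - f) := by
    have h1 : S.card * f.factorial ≤ n ^ (n - f) * f.factorial := by
      calc S.card * f.factorial ≤ n.factorial := hpack
        _ = f.factorial * n.descFactorial (n - f) := hdesc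
        _ ≤ f.factorial * n ^ (n - f) := Nat.mul_le_mul_left _ (Nat.descFactorial_le_pow _ _)
        _ = n ^ (n - f) * f.factorial := mul_comm _ _
    exact Nat.le_of_mul_le_mul_right h1 (Nat.factorial_pos f)
  have hm3 : 3 * (n - f) ≤ n := by omega
  -- real form: `|S| ≤ n^{n/3} = exp((n/3) log n)`
  have hS' : (S.card : ℝ) ≤ Real.exp ((n : ℝ) / 3 * Real.log n) := by
    have h1 : (S.card : ℝ) ≤ (n : ℝ) ^ (n - f) := by exact_mod_cast hS
    have h2 : (n : ℝ) ^ (n - f) ≤ (n : ℝ) ^ ((n : ℝ) / 3) := by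
      rw [← Real.rpow_natCast]
      refine Real.rpow_le_rpow_of_exponent_le (by exact_mod_cast hn1) ?_
      have : ((n - f : ℕ) : ℝ) * 3 ≤ n := by exact_mod_cast (by omega : (n - f) * 3 ≤ n)
      linarith
    rw [Real.rpow_def_of_pos hn0, mul_comm] at h2
    exact h1.trans h2
  -- the exponent inequality `(n/3) log n ≤ ½ log n! - c√n`
  have hsqrt : c * Real.sqrt n ≤ n / 2 := by
    have hs0 : 0 ≤ Real.sqrt n := Real.sqrt_nonneg _
    have hss : Real.sqrt n * Real.sqrt n = n := Real.mul_self_sqrt hn0.le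
    have h2c : 2 * c ≤ Real.sqrt n := by
      rw [show 2 * c = Real.sqrt ((2 * c) ^ 2) from (Real.sqrt_sq (by linarith)).symm]
      exact Real.sqrt_le_sqrt (by linarith)
    nlinarith
  have hlogF := Literature.Combinatorics.Enumerative.cast_mul_log_sub_le_log_factorial n
  have hkey : (n : ℝ) / 3 * Real.log n ≤ Real.log (n.factorial : ℝ) / 2 - c * Real.sqrt n := by
    have h6 : (n : ℝ) ≤ (n : ℝ) / 6 * Real.log n := by nlinarith [hlog6, hn0]
    nlinarith [hlogF, hsqrt, h6, hn0, hlog6]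
  have hF0 : (0 : ℝ) < (n.factorial : ℝ) := by exact_mod_cast Nat.factorial_pos n
  calc (S.card : ℝ) ≤ Real.exp ((n : ℝ) / 3 * Real.log n) := hS'
    _ ≤ Real.exp (Real.log (n.factorial : ℝ) / 2 - c * Real.sqrt n) := Real.exp_le_exp.2 hkey
    _ = Real.sqrt (n.factorial : ℝ) * Real.exp (-(c * Real.sqrt (n : ℝ))) := by
        rw [sub_eq_add_neg, Real.exp_add]
        congr 1
        rw [Real.sqrt_eq_rpow (n.factorial : ℝ), Real.rpow_def_of_pos hF0]
        congr 1
        ring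

end TrialityLine


-- Targets (gen 2, cycle 1): `payload.targets` / `stuck_stubs` are EMPTY.  Line `interleaved-subsignature-ascent`
-- (payload.line; lead c1-0) has ONE open stub `stub_design` = `X` on chain classes, declared DEAD by its lead
-- (Lines/interleaved-subsignature-ascent-dead.md); §7 records its load-bearing analysis.  The lead's next
-- preference `triality-uniquely-cubing-translate` has ONE open stub `stub_trialityChainDesign`; §8 shows it is
-- `C⁺ = TrialityThreshold` plus a fibre bound the glue never uses, and §8b prices the twist's fixed points.
-- No stub of either line is refuted: each open stub is `X` restricted to a host family containing all
-- subgroup (resp. all Young) designs, i.e. an instance of BCCGU 2017 §4's open question.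

end Summit.MatrixMultiplication.MatrixMultiplication.Cruxes.ThresholdSubsetTriples.Disproof

end
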